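import Literature.Barriers.CriticalPhenomena.LaceExpansionIsingDeconvolutionThm22Data
import Literature.Barriers.CriticalPhenomena.LaceExpansionMomentTaylorBounds
import Literature.Barriers.CriticalPhenomena.LaceExpansionSpreadOutSymbolLq
import Literature.Barriers.CriticalPhenomena.LaceExpansionIsingDeconvolutionPartsEstimates
import Literature.Barriers.CriticalPhenomena.LaceExpansionSmallBallLpNorms
import Literature.Barriers.CriticalPhenomena.LaceExpansionGaussianDeconvolutionWL
import Literature.Barriers.CriticalPhenomena.LaceExpansionGaussianDeconvolutionTrigSums
import HarnessLib

/-!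
# Liu–Slade 2026, Proposition 3.2 (towards `LiuSlade2026_thm22_holds`), III–V: Lemma 3.3 for the
# `E`-facts, the `A`-blocks and the `F`-blocks

Barrier catalogue `Literature/Barriers/CriticalPhenomena/` (D-0021), proofs companion of the named
fact `LiuSlade2026_thm22` (Liu–Slade 2026, Theorem 2.2), continuing `…Thm22Data.lean`. Three parts,
each with its own header below: (III) the moments and decay of `E = A_μ - λF` ((3.4), (3.20)–(3.21));
(IV) Lemma 3.3 for the blocks `Â_γ/(Â+λm²)` ((3.15)–(3.19)); (V) Lemma 3.3 for the blocks
`F̂_γ/(F̂+m²)` ((3.22)–(3.24)) — pure derivatives, uniformly over the admissible regularised data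
`LSData`, in the classical/massive setting of the cube reduction `LiuSlade2026_thm22_of_prop32_cube`.

## References

* Y. Liu, G. Slade, *Gaussian deconvolution and the lace expansion for spread-out models*,
  Ann. Inst. H. Poincaré Probab. Statist. 62 (2026), arXiv:2310.07640: Lemma 3.3 and its proof,
  (3.4), (3.10)–(3.24), Lemma 3.4, Lemma 3.5 [LiuSlade2026].
-/

/-!
# Liu–Slade 2026, Proposition 3.2 (towards `LiuSlade2026_thm22_holds`), III: the function
# `E = A_μ - λF` — vanishing moments (3.4), the decay (3.20), and Lemma 3.4 for `Ê_γ`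

Barrier catalogue `Literature/Barriers/CriticalPhenomena/` (D-0021), proofs companion of the
named fact `LiuSlade2026_thm22`, continuing `LaceExpansionIsingDeconvolutionThm22Data.lean`. For an
admissible datum `i : LSData …` (Assumption 2.1, finitely supported `Π_z`, mass) this file PROVES
the x-space facts about `E_{z,λ_z,μ_z} = A_{μ_z} - λ_zF_z` that the `E`-block estimates of
Lemma 3.3 consume:

* `LSData.tsum_F`, `LSData.tsum_A`, `LSData.tsum_E`, `LSData.tsum_sq_mul_E` — "The choice of
  `λ_z, μ_z` in (2.4) has been made to ensure that `Σ_x E(x) = Σ_x |x|²E(x) = 0`" (3.4);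
* `LSData.abs_lam_mul_z_sub_mu_le` — `|λ_z z - μ_z| ≤ 4K_λβ` (from `λ = 1 + O(β)`, `|Π̂(0)| ≲ β`);
* `LSData.abs_E_le` — **(3.20)**: `|E(x)| ≤ C_E β L^{2+ρ₂}/⟦x⟧^{d+2+ρ₂}`, `ρ₂ = ρ ∧ 2`, with
  `C_E = 2K_λ + 4K_λ d^{(d+2+ρ₂)/2} + 4` ("we have relaxed the decay of `Π` because it is costly to
  make `D` decay": `D(x) ≲ L^{2+ρ₂}/⟦x⟧^{d+2+ρ₂}`, the tree's `soStep_le_pow_mul_div_jnorm_rpow`);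
* `LSData.abs_symE_le` — **(3.21)**, Lemma 3.4 applied: for `0 ≤ σ < ρ₂`, `σ ≤ 2`, `γ < 2 + σ`,
  `|Ê_γ(k)| ≤ 3 C_E β L^{2+ρ₂} (Σ⟦x⟧^{-(d+ρ₂-σ)}) |k|^{2+σ-γ}` (`abs_tsum_moment_cos_le`).

## References

* Y. Liu, G. Slade, *Gaussian deconvolution and the lace expansion for spread-out models*,
  Ann. Inst. H. Poincaré Probab. Statist. 62 (2026), arXiv:2310.07640: (2.4)–(2.6), (3.3)–(3.4),
  (3.12), (3.20)–(3.21), Lemma 3.4 [LiuSlade2026].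
-/

noncomputable section

namespace Literature.Barriers.CriticalPhenomena.SpreadOutIsing

open _root_.MeasureTheory Filter _root_.Topology Finset Literature.Probability.LatticeModels
open scoped BigOperators Real

variable {d : ℕ}

namespace LSData

variable {ρ βs K Kl : ℝ} {L₀ : ℕ} (i : LSData d ρ βs K Kl L₀)

/-! ## The sums of `F`, `A`, `E`: (2.5) and (3.4) -/

/-- `Σ_x F_z(x) = 1 - z - Σ_x Π_z(x)` (2.5). [cite: LiuSlade2026, (2.5)] -/
theorem tsum_F (hd : 1 ≤ d) (hL₀ : 1 ≤ L₀) : ∑' x, i.F x = 1 - i.z - ∑' x, i.P x :=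
  (hasSum_lsF hd (i.one_le_L hL₀) i.z i.summable_abs_P.of_abs).tsum_eq

/-- `Σ_x A_μ(x) = 1 - μ`. [folklore] -/
theorem tsum_A (hd : 1 ≤ d) (hL₀ : 1 ≤ L₀) : ∑' x, i.A x = 1 - i.mu := by
  have h := (hasSum_delta0 (d := d)).sub ((hasSum_soStep hd (i.one_le_L hL₀)).mul_left i.mu)
  rw [mul_one] at h
  exact h.tsum_eq

/-- **`Σ_x E(x) = 0`** (`μ = 1 - λF̂(0)`). [cite: LiuSlade2026, (3.4)] -/
theorem tsum_E (hd : 1 ≤ d) (hL₀ : 1 ≤ L₀) : ∑' x, i.E x = 0 := by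
  have hAs : Summable i.A := summable_of_ne_finset_zero (s := i.supp) fun x hx => i.A_eq_zero hx
  have hFs : Summable i.F := i.summable_abs_F.of_abs
  have h : ∑' x, i.E x = ∑' x, i.A x - i.lam * ∑' x, i.F x := by
    rw [← tsum_mul_left, ← Summable.tsum_sub hAs (hFs.mul_left _)]
    rfl
  rw [h, i.tsum_A hd hL₀]
  simp only [mu, lam, lsMu, F]
  ring

/-- `Σ_x |x|² A_μ(x) = -μσ²`. [folklore] -/
theorem tsum_sq_mul_A : ∑' x, euclidNorm x ^ 2 * i.A x = -(i.mu * soVariance d i.L) := by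
  have hδ : HasSum (fun x : Site d => euclidNorm x ^ 2 * delta0 x) 0 := by
    simp_rw [sq_mul_delta0]; exact hasSum_zero
  have h := hδ.sub ((hasSum_sq_mul_soStep (d := d) (L := i.L)).mul_left i.mu)
  rw [zero_sub] at h
  refine (HasSum.tsum_eq ?_)
  refine h.congr_fun fun x => ?_
  simp only [A, soA]
  ring

/-- **`Σ_x |x|² E(x) = 0`** (the second equation of the linear system solved by (2.4)).
[cite: LiuSlade2026, (3.4) and (2.4)] -/
theorem tsum_sq_mul_E (hd : 1 ≤ d) (hL₀ : 1 ≤ L₀) : ∑' x, euclidNorm x ^ 2 * i.E x = 0 := by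
  have hL := i.one_le_L hL₀
  have hσ : 0 < soVariance d i.L := soVariance_pos hd hL
  have hA2 : Summable fun x => euclidNorm x ^ 2 * i.A x :=
    summable_of_ne_finset_zero (s := i.supp) fun x hx => by rw [i.A_eq_zero hx, mul_zero]
  have hF2 : Summable fun x => euclidNorm x ^ 2 * i.F x :=
    summable_of_ne_finset_zero (s := i.supp) fun x hx => by rw [i.F_eq_zero hx, mul_zero]
  have h : ∑' x, euclidNorm x ^ 2 * i.E x = ∑' x, euclidNorm x ^ 2 * i.A x - i.lam * ∑' x, euclidNorm x ^ 2 * i.F x := by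
    rw [← tsum_mul_left, ← Summable.tsum_sub hA2 (hF2.mul_left _)]
    exact tsum_congr fun x => by simp only [E]; ring
  rw [h, i.tsum_sq_mul_A]
  -- `λ = 1/(F̂(0) - σ⁻²Σ|x|²F)`, `μ = 1 - λF̂(0)`; with `λ > 0` solve for `Σ|x|²F`
  set s₀ : ℝ := ∑' x, i.F x with hs₀
  set s₂ : ℝ := ∑' x, euclidNorm x ^ 2 * i.F x with hs₂
  have hlamdef : i.lam = (s₀ - (soVariance d i.L)⁻¹ * s₂)⁻¹ := rfl
  have hmudef : i.mu = 1 - i.lam * s₀ := rfl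
  have hlampos := i.lam_pos
  have hden : s₀ - (soVariance d i.L)⁻¹ * s₂ ≠ 0 := by
    intro h0; rw [hlamdef, h0, inv_zero] at hlampos; exact lt_irrefl _ hlampos
  have hs₂eq : s₂ = soVariance d i.L * (s₀ - i.lam⁻¹) := by
    rw [hlamdef, inv_inv]; field_simp; ring
  rw [hmudef, hs₂eq]
  field_simp
  ring

/-! ## `|λz - μ| ≤ 4K_λβ` -/

/-- `λ_z z - μ_z = (λ_z - 1) - λ_z Σ_x Π_z(x)`, so `|λ_z z - μ_z| ≤ 4K_λ β` (`λ ≤ 2`).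
[cite: LiuSlade2026, (2.5)–(2.6) and (3.12)] -/
theorem abs_lam_mul_z_sub_mu_le (hd : 1 ≤ d) (hL₀ : 1 ≤ L₀) : |i.lam * i.z - i.mu| ≤ 4 * Kl * i.β := by
  have hF := i.tsum_F hd hL₀
  have hrepr : i.lam * i.z - i.mu = (i.lam - 1) - i.lam * ∑' x, i.P x := by
    have hmudef : i.mu = 1 - i.lam * ∑' x, i.F x := rfl
    rw [hmudef, hF]; ring
  rw [hrepr]
  have h1 : |i.lam - 1| ≤ 2 * Kl * i.β := i.hlam1
  have h2 : |i.lam * ∑' x, i.P x| ≤ 2 * (Kl * i.β) := by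
    rw [abs_mul, abs_of_pos i.lam_pos]
    exact mul_le_mul i.lam_le_two i.hSP (abs_nonneg _) zero_le_two
  calc |i.lam - 1 - i.lam * ∑' x, i.P x| ≤ |i.lam - 1| + |i.lam * ∑' x, i.P x| := abs_sub _ _
    _ ≤ 2 * Kl * i.β + 2 * (Kl * i.β) := add_le_add h1 h2
    _ = 4 * Kl * i.β := by ring

/-! ## (3.20): the decay of `E` -/

/-- The constant of (3.20) (depends on `d, ρ` and `K_λ` only). [cite: LiuSlade2026, (3.20)] -/
def CE (d : ℕ) (ρ Kl : ℝ) : ℝ := 2 * Kl + 4 * Kl * (d : ℝ) ^ (((d : ℝ) + 2 + min ρ 2) / 2) + 4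

/-- `CE_nonneg` (elementary API). [folklore] -/
theorem CE_nonneg (hKl : 0 ≤ Kl) : 0 ≤ CE d ρ Kl := by unfold CE; positivity

/-- **Liu–Slade 2026, (3.20)**: `|E(x)| ≤ C_E β L^{2+ρ₂}/⟦x⟧^{d+2+ρ₂}`, `ρ₂ = ρ ∧ 2`, for every
`x ∈ ℤ^d` (from `E = (1-λ)δ + (λz-μ)D + λΠ` in x-space, `|1-λ| ≤ 2K_λβ`, `|λz-μ| ≤ 4K_λβ`,
`λ ≤ 2`, the decay `D(x) ≤ d^{(d+2+ρ₂)/2}L^{2+ρ₂}/⟦x⟧^{d+2+ρ₂}` (3.14) and (2.2)).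
[cite: LiuSlade2026, (3.20)] -/
theorem abs_E_le (hd : 1 ≤ d) (hL₀ : 1 ≤ L₀) (hρ : 0 < ρ) (hKl : 0 ≤ Kl) (x : Site d) :
    |i.E x| ≤ CE d ρ Kl * i.β * (i.L : ℝ) ^ (2 + min ρ 2) / jnorm x ^ ((d : ℝ) + 2 + min ρ 2) := by
  have hL := i.one_le_L hL₀
  have hL1 : (1 : ℝ) ≤ i.L := by exact_mod_cast hL
  set ρ₂ : ℝ := min ρ 2 with hρ₂
  have hρ₂0 : 0 < ρ₂ := lt_min hρ two_pos
  have hρ₂ρ : ρ₂ ≤ ρ := min_le_left _ _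
  have hβ := i.β_nonneg
  have hj := jnorm_pos x
  have hj1 := one_le_jnorm x
  set w : ℝ := jnorm x ^ ((d : ℝ) + 2 + ρ₂) with hw
  have hw0 : 0 < w := Real.rpow_pos_of_pos hj _
  have hw1 : 1 ≤ w := Real.one_le_rpow hj1 (by positivity)
  -- x-space decomposition `E = (1-λ)δ + (λz-μ)D + λΠ`
  have hE : i.E x = (1 - i.lam) * delta0 x + (i.lam * i.z - i.mu) * soStep d i.L x + i.lam * i.P x := by
    simp only [E, A, soA, F, lsF]; ring
  -- the three pieces
  have hδ : |(1 - i.lam) * delta0 x| ≤ 2 * Kl * i.β / w := by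
    rw [abs_mul, abs_of_nonneg (delta0_nonneg x)]
    have h1 : |1 - i.lam| ≤ 2 * Kl * i.β := by rw [abs_sub_comm]; exact i.hlam1
    calc |1 - i.lam| * delta0 x ≤ 2 * Kl * i.β * (1 / w) :=
          mul_le_mul h1 (delta0_le_one_div_jnorm_rpow x _) (delta0_nonneg x) (by positivity)
      _ = 2 * Kl * i.β / w := by ring
  have hD : |(i.lam * i.z - i.mu) * soStep d i.L x| ≤
      4 * Kl * i.β * ((d : ℝ) ^ (((d : ℝ) + 2 + ρ₂) / 2) * (i.L : ℝ) ^ (2 + ρ₂)) / w := by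
    rw [abs_mul, abs_of_nonneg (soStep_nonneg x)]
    have h1 := i.abs_lam_mul_z_sub_mu_le hd hL₀
    have h2 := soStep_le_pow_mul_div_jnorm_rpow hd hL (a := 2 + ρ₂) (by linarith) x
    rw [show (d : ℝ) + (2 + ρ₂) = (d : ℝ) + 2 + ρ₂ by ring] at h2
    calc |i.lam * i.z - i.mu| * soStep d i.L x
        ≤ 4 * Kl * i.β * ((d : ℝ) ^ (((d : ℝ) + 2 + ρ₂) / 2) * (i.L : ℝ) ^ (2 + ρ₂) / w) :=
          mul_le_mul h1 h2 (soStep_nonneg x) (by positivity)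
      _ = _ := by ring
  have hP : |i.lam * i.P x| ≤ 4 * i.β / w := by
    rw [abs_mul, abs_of_pos i.lam_pos]
    have h1 := i.abs_P_le x
    have h2 : i.β₀ * delta0 x + i.β₁ / jnorm x ^ ((d : ℝ) + 2 + ρ) ≤ 2 * i.β / w := by
      have hδ' : i.β₀ * delta0 x ≤ i.β * (1 / w) :=
        mul_le_mul i.β₀_le_β (delta0_le_one_div_jnorm_rpow x _) (delta0_nonneg x) hβ
      have hρw : i.β₁ / jnorm x ^ ((d : ℝ) + 2 + ρ) ≤ i.β / w := by
        have : w ≤ jnorm x ^ ((d : ℝ) + 2 + ρ) := Real.rpow_le_rpow_of_exponent_le hj1 (by linarith)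
        calc i.β₁ / jnorm x ^ ((d : ℝ) + 2 + ρ) ≤ i.β₁ / w := div_le_div_of_nonneg_left i.hβ₁ hw0 this
          _ ≤ i.β / w := div_le_div_of_nonneg_right i.β₁_le_β hw0.le
      calc i.β₀ * delta0 x + i.β₁ / jnorm x ^ ((d : ℝ) + 2 + ρ) ≤ i.β * (1 / w) + i.β / w := add_le_add hδ' hρw
        _ = 2 * i.β / w := by ring
    calc i.lam * |i.P x| ≤ 2 * (2 * i.β / w) := mul_le_mul i.lam_le_two (h1.trans h2) (abs_nonneg _) zero_le_two
      _ = 4 * i.β / w := by ring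
  -- assemble
  rw [hE]
  have hLpow : (1 : ℝ) ≤ (i.L : ℝ) ^ (2 + ρ₂) := Real.one_le_rpow hL1 (by linarith)
  calc |(1 - i.lam) * delta0 x + (i.lam * i.z - i.mu) * soStep d i.L x + i.lam * i.P x|
      ≤ |(1 - i.lam) * delta0 x| + |(i.lam * i.z - i.mu) * soStep d i.L x| + |i.lam * i.P x| := (abs_add_le _ _).trans (add_le_add (abs_add_le _ _) le_rfl)
    _ ≤ 2 * Kl * i.β / w + 4 * Kl * i.β * ((d : ℝ) ^ (((d : ℝ) + 2 + ρ₂) / 2) * (i.L : ℝ) ^ (2 + ρ₂)) / w +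
          4 * i.β / w := add_le_add (add_le_add hδ hD) hP
    _ = (2 * Kl + 4 * Kl * (d : ℝ) ^ (((d : ℝ) + 2 + ρ₂) / 2) * (i.L : ℝ) ^ (2 + ρ₂) + 4) * i.β / w := by
        field_simp
    _ ≤ CE d ρ Kl * i.β * (i.L : ℝ) ^ (2 + ρ₂) / w := by
        rw [div_le_div_iff_of_pos_right hw0]
        have hcoef : 2 * Kl + 4 * Kl * (d : ℝ) ^ (((d : ℝ) + 2 + ρ₂) / 2) * (i.L : ℝ) ^ (2 + ρ₂) + 4 ≤
            CE d ρ Kl * (i.L : ℝ) ^ (2 + ρ₂) := by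
          unfold CE
          rw [← hρ₂]
          have hd0 : (0 : ℝ) ≤ (d : ℝ) ^ (((d : ℝ) + 2 + ρ₂) / 2) := by positivity
          nlinarith [mul_nonneg hKl hd0, mul_nonneg hKl (sub_nonneg.2 hLpow)]
        calc (2 * Kl + 4 * Kl * (d : ℝ) ^ (((d : ℝ) + 2 + ρ₂) / 2) * (i.L : ℝ) ^ (2 + ρ₂) + 4) * i.β
            ≤ CE d ρ Kl * (i.L : ℝ) ^ (2 + ρ₂) * i.β := mul_le_mul_of_nonneg_right hcoef hβ
          _ = CE d ρ Kl * i.β * (i.L : ℝ) ^ (2 + ρ₂) := by ring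

/-! ## (3.21): Lemma 3.4 for `Ê_γ` -/

/-- **Liu–Slade 2026, (3.21)**: for `0 ≤ σ < ρ₂ = ρ ∧ 2`, `σ ≤ 2` and `γ < 2 + σ`,
`|Ê_γ(k)| ≤ 3 C_E β L^{2+ρ₂} (Σ_x⟦x⟧^{-(d+ρ₂-σ)}) |k|^{2+σ-γ}` on all of `ℝ^d` (`|k| = knorm k`;
Lemma 3.4 with `K = C_E β L^{2+ρ₂}` and `ρ₂` in place of `ρ`, "it is here that we require the
strict inequality `σ < ρ₂`"). [cite: LiuSlade2026, (3.21) and Lemma 3.4] -/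
theorem abs_symE_le (hd : 1 ≤ d) (hL₀ : 1 ≤ L₀) (hρ : 0 < ρ) (hKl : 0 ≤ Kl) (l : Fin d) {σ : ℝ}
    (hσ0 : 0 ≤ σ) (hσρ : σ < min ρ 2) (hσ2 : σ ≤ 2) {γ : ℕ} (hγ : (γ : ℝ) < 2 + σ) (k : Fin d → ℝ) :
    |i.symE l γ k| ≤ 3 * (CE d ρ Kl * i.β * (i.L : ℝ) ^ (2 + min ρ 2)) *
      (∑' x : Site d, jnorm x ^ (-((d : ℝ) + min ρ 2 - σ))) * knorm k ^ (2 + σ - γ) := by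
  have hρ₂0 : 0 < min ρ 2 := lt_min hρ two_pos
  have hKE : 0 ≤ CE d ρ Kl * i.β * (i.L : ℝ) ^ (2 + min ρ 2) :=
    mul_nonneg (mul_nonneg (CE_nonneg hKl) i.β_nonneg) (Real.rpow_nonneg (Nat.cast_nonneg _) _)
  exact abs_tsum_moment_cos_le i.isZdSymmetric_E hKE hρ₂0 (fun x => i.abs_E_le hd hL₀ hρ hKl x)
    hσ0 hσρ hσ2 (i.tsum_E hd hL₀) (i.tsum_sq_mul_E hd hL₀) l hγ k

end LSData

end Literature.Barriers.CriticalPhenomena.SpreadOutIsing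

end


/-!
# Liu–Slade 2026, Proposition 3.2 (towards `LiuSlade2026_thm22_holds`), IV: Lemma 3.3 for the
# blocks `Â_γ/(Â + λm²)` — (3.19), `‖Â_γ/Â‖_q ≲ L^{|γ| - d/q}`

Barrier catalogue `Literature/Barriers/CriticalPhenomena/` (D-0021), proofs companion of the
named fact `LiuSlade2026_thm22`, continuing `LaceExpansionIsingDeconvolutionThm22Data.lean`. This
file PROVES the first third of Lemma 3.3 in the classical/massive setting of the sequel: "Bound on
`Â_γ/Â`. … We will prove that, for `|γ| ≥ 1`, `‖Â_γ/Â‖_q ≲ L^{|γ|-d/q}` (`(|γ|∧2)/d < q⁻¹ < 1`)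
(3.19) … By the infrared bound (3.15), `|Â_γ/Â| ≲ L^{-2}|k|^{-2}|Â_γ|1_{B_L} + |Â_γ|`; the
`L^q` norm of the second term is bounded by `L^{|γ|-d/q}` by (3.16); if `|γ| = 1`, Taylor's
/-- `and` (elementary API). [folklore] -/
theorem and symmetry give `|Â_γ| ≲ L²|k|`, so the first term is bounded by `|k|^{-1}1_{B_L}`,
which has `L^q` norm bounded by `L^{1-d/q}`; for `|γ| ≥ 2` … `≲ L^{|γ|-d/q}`" — for the pure
derivatives `γ e_l`, over the admissible data `LSData` (uniformly), on the cube with Lebesgue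
measure and the sup norm `‖k‖` (`B_L = {‖k‖ < 1/L}`):

* `LSData.den_A` — `Â_{μ_z} + λm² ≥ (1/32)(L²‖k‖² ∧ 1)` on the cube (`Â_μ ≥ (1 - D̂)/2` for
  `μ ∈ [0,1]` and the tree's infrared bound `infrared_lower_bound` for `D̂`);
* `LSData.abs_Ablk_le` — the pointwise majorant
  `|Â_γ/(Â+λm²)| ≤ 32|∂_l^γD̂| + 32d L^{γ-a}‖k‖^{-a}1_{B_L}`, `a = γ ∧ 2` (a.e., off `k = 0`);
* `LSData.eLpNorm_Ablk_le` — **(3.19)**: for `1 < q` with `γ/d < 1/q`,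
  `‖Â_γ/(Â+λm²)‖_{L^q([-π,π]^d)} ≤ C_A(d,γ,q) L^{γ - d/q}` uniformly over the data
  (`eLpNorm_soSymbolD_le` (3.16) off the ball, the sup bound `|∂_l^γD̂| ≤ L^γ` and the small-ball
  norms `‖ ‖k‖^{-a}1_{B_L} ‖_q ≲ L^{a-d/q}` on it — the source's Hölder step with `r = ∞`);
* `isWL_Ablk` — hence the family `i ↦ Â_γ/(Â+λm²)` is of weak Lebesgue class `γ` (`LS24.IsWL`),
  the form consumed by the Hölder bookkeeping.

## References

* Y. Liu, G. Slade, *Gaussian deconvolution and the lace expansion for spread-out models*,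
  Ann. Inst. H. Poincaré Probab. Statist. 62 (2026), arXiv:2310.07640: Lemma 3.3 with
  (3.10)–(3.11), its proof ("Bound on Â_γ/Â", (3.19)), Lemma 3.6 (3.15)–(3.16) [LiuSlade2026].
-/

noncomputable section

namespace Literature.Barriers.CriticalPhenomena.SpreadOutIsing

open _root_.MeasureTheory Filter _root_.Topology Finset Literature.Probability.LatticeModels
open scoped BigOperators Real ENNReal NNReal

variable {d : ℕ}

namespace LSData

variable {ρ βs K Kl : ℝ} {L₀ : ℕ} (i : LSData d ρ βs K Kl L₀) (l : Fin d)

/-! ## The denominator `Â + λm²` -/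

/-- **`Â_{μ_z} + λm² ≥ (1/32)(L²‖k‖² ∧ 1)` on the cube** (`Â_μ = 1 - μD̂ ≥ (1 - D̂)/2` for `μ ∈ [0,1]`,
`|D̂| ≤ 1`, and `1 - D̂ ≥ (1/16)(L²‖k‖² ∧ 1)`, the tree's `infrared_lower_bound`).
[cite: LiuSlade2026, Lemma 3.6 (3.15)] -/
theorem den_A (hd : 1 ≤ d) (hL₀ : 1 ≤ L₀) {k : Fin d → ℝ} (hk : k ∈ cube d) :
    1 / 32 * min ((i.L : ℝ) ^ 2 * ‖k‖ ^ 2) 1 ≤ i.Am l k := by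
  have hL := i.one_le_L hL₀
  have hIR := infrared_lower_bound hd hL hk
  have hA0 : i.symA l 0 k = 1 - i.mu * soSymbol d i.L k := by
    rw [i.symA_eq l 0 k, if_pos rfl, soSymbolD_zero]
  have hD := abs_soSymbol_le_one (d := d) (L := i.L) k
  have hhalf : (1 - soSymbol d i.L k) / 2 ≤ i.symA l 0 k := by
    rw [hA0]
    rcases le_or_gt 0 (soSymbol d i.L k) with h | h
    · nlinarith [mul_le_mul_of_nonneg_right i.mu_le_one h, (abs_le.1 hD).2]
    · nlinarith [i.mu_nonneg, (abs_le.1 hD).1]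
  have := i.lam_mul_mass_le_Am l k
  have hpos : 0 ≤ i.lam * i.mass := (mul_pos i.lam_pos i.hmass).le
  unfold Am at *
  linarith

/-! ## The pointwise majorant -/

/-- For `γ ≥ 1`: `|Â_γ| = μ|∂_l^γ D̂| ≤ |∂_l^γ D̂|`. [folklore] -/
theorem abs_symA_le {γ : ℕ} (hγ : 1 ≤ γ) (k : Fin d → ℝ) : |i.symA l γ k| ≤ |soSymbolD d i.L l γ k| := by
  rw [i.symA_eq l γ k, if_neg (by omega), zero_sub, abs_neg, abs_mul, abs_of_nonneg i.mu_nonneg]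
  exact mul_le_of_le_one_left (abs_nonneg _) i.mu_le_one

/-- **The pointwise majorant of `Â_γ/(Â+λm²)`** on the cube off the origin: with `a = γ ∧ 2`,
`|Â_γ/(Â+λm²)| ≤ 32|∂_l^γ D̂(k)| + 32 d L^{γ-a} ‖k‖^{-a} 1_{‖k‖<1/L}` (`γ ≥ 1`; off the ball
`L²‖k‖² ≥ 1`; on it `|∂_lD̂| ≤ dL²‖k‖`, `|∂_l^γD̂| ≤ L^γ`).
[cite: LiuSlade2026, proof of Lemma 3.3 ((3.19) and the two displays following it)] -/
theorem abs_Ablk_le (hd : 1 ≤ d) (hL₀ : 1 ≤ L₀) {γ : ℕ} (hγ : 1 ≤ γ) {k : Fin d → ℝ} (hk : k ∈ cube d)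
    (hk0 : k ≠ 0) :
    |i.Ablk l γ k| ≤ 32 * |soSymbolD d i.L l γ k| +
      32 * d * (i.L : ℝ) ^ ((γ : ℝ) - min (γ : ℝ) 2) *
        (Metric.ball (0 : Fin d → ℝ) (i.L : ℝ)⁻¹).indicator (fun k => ‖k‖ ^ (-(min (γ : ℝ) 2))) k := by
  have hL := i.one_le_L hL₀
  have hL1 : (1 : ℝ) ≤ i.L := by exact_mod_cast hL
  have hL0 : (0 : ℝ) < i.L := by linarith
  have hden := i.den_A l hd hL₀ hk
  have hAm := i.Am_pos l k
  have hkn : 0 < ‖k‖ := norm_pos_iff.2 hk0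
  have hnum := i.abs_symA_le l hγ k
  have hsD := abs_nonneg (soSymbolD d i.L l γ k)
  rw [Ablk, abs_div, abs_of_pos hAm]
  by_cases hball : ‖k‖ < (i.L : ℝ)⁻¹
  · -- on the ball: `min = L²‖k‖²`
    have hmem : k ∈ Metric.ball (0 : Fin d → ℝ) (i.L : ℝ)⁻¹ := by simpa using hball
    rw [Set.indicator_of_mem hmem]
    have hLk : (i.L : ℝ) ^ 2 * ‖k‖ ^ 2 < 1 := by
      have h1 : (i.L : ℝ) * ‖k‖ < 1 := by
        calc (i.L : ℝ) * ‖k‖ < i.L * (i.L : ℝ)⁻¹ := mul_lt_mul_of_pos_left hball hL0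
          _ = 1 := mul_inv_cancel₀ hL0.ne'
      have h0 : 0 ≤ (i.L : ℝ) * ‖k‖ := by positivity
      nlinarith
    have hmin : min ((i.L : ℝ) ^ 2 * ‖k‖ ^ 2) 1 = (i.L : ℝ) ^ 2 * ‖k‖ ^ 2 := min_eq_left hLk.le
    rw [hmin] at hden
    have hw : 0 < (i.L : ℝ) ^ 2 * ‖k‖ ^ 2 := by positivity
    -- `|Â_γ| ≤ d L^{γ - a + 2} ‖k‖^{2 - a}` in both cases `γ = 1`, `γ ≥ 2`
    have hkey : |soSymbolD d i.L l γ k| ≤ d * (i.L : ℝ) ^ ((γ : ℝ) - min (γ : ℝ) 2) *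
        ((i.L : ℝ) ^ 2 * ‖k‖ ^ 2) * ‖k‖ ^ (-(min (γ : ℝ) 2)) := by
      rcases Nat.lt_or_ge γ 2 with hγ2 | hγ2
      · -- `γ = 1`
        have hγ1 : γ = 1 := by omega
        subst hγ1
        have hm : min ((1 : ℕ) : ℝ) 2 = 1 := by norm_num
        rw [hm]
        simp only [Nat.cast_one, sub_self, Real.rpow_zero, mul_one]
        calc |soSymbolD d i.L l 1 k| ≤ d * (i.L : ℝ) ^ 2 * ‖k‖ := abs_soSymbolD_one_le hd hL l k
          _ = d * ((i.L : ℝ) ^ 2 * ‖k‖ ^ 2) * ‖k‖ ^ (-(1 : ℝ)) := by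
              rw [Real.rpow_neg hkn.le, Real.rpow_one]; field_simp
      · have hm : min (γ : ℝ) 2 = 2 := min_eq_right (by exact_mod_cast hγ2)
        rw [hm]
        have hd1 : (1 : ℝ) ≤ d := by exact_mod_cast hd
        calc |soSymbolD d i.L l γ k| ≤ (i.L : ℝ) ^ γ := abs_soSymbolD_le hd hL l γ k
          _ ≤ d * (i.L : ℝ) ^ γ := le_mul_of_one_le_left (by positivity) hd1
          _ = d * (i.L : ℝ) ^ ((γ : ℝ) - 2) * ((i.L : ℝ) ^ 2 * ‖k‖ ^ 2) * ‖k‖ ^ (-(2 : ℝ)) := by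
              rw [Real.rpow_neg hkn.le, Real.rpow_two, Real.rpow_sub hL0, Real.rpow_natCast, Real.rpow_two]
              field_simp
    calc |i.symA l γ k| / i.Am l k ≤ |soSymbolD d i.L l γ k| / (1 / 32 * ((i.L : ℝ) ^ 2 * ‖k‖ ^ 2)) :=
          div_le_div₀ hsD hnum (by positivity) hden
      _ = 32 * (|soSymbolD d i.L l γ k| / ((i.L : ℝ) ^ 2 * ‖k‖ ^ 2)) := by field_simp
      _ ≤ 32 * (d * (i.L : ℝ) ^ ((γ : ℝ) - min (γ : ℝ) 2) * ‖k‖ ^ (-(min (γ : ℝ) 2))) := by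
          refine mul_le_mul_of_nonneg_left ?_ (by norm_num)
          rw [div_le_iff₀ hw]
          calc |soSymbolD d i.L l γ k| ≤ _ := hkey
            _ = d * (i.L : ℝ) ^ ((γ : ℝ) - min (γ : ℝ) 2) * ‖k‖ ^ (-(min (γ : ℝ) 2)) * ((i.L : ℝ) ^ 2 * ‖k‖ ^ 2) := by ring
      _ = 32 * d * (i.L : ℝ) ^ ((γ : ℝ) - min (γ : ℝ) 2) * ‖k‖ ^ (-(min (γ : ℝ) 2)) := by ring
      _ ≤ _ := by linarith [mul_nonneg (by norm_num : (0:ℝ) ≤ 32) hsD]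
  · -- off the ball: `min = 1`
    have hmem : k ∉ Metric.ball (0 : Fin d → ℝ) (i.L : ℝ)⁻¹ := by simpa using hball
    rw [Set.indicator_of_notMem hmem, mul_zero, add_zero]
    have hLk : 1 ≤ (i.L : ℝ) ^ 2 * ‖k‖ ^ 2 := by
      have h1 : 1 ≤ (i.L : ℝ) * ‖k‖ := by
        rw [not_lt, inv_le_iff_one_le_mul₀ hL0] at hball
        linarith [hball]
      nlinarith
    rw [min_eq_right hLk] at hden
    calc |i.symA l γ k| / i.Am l k ≤ |soSymbolD d i.L l γ k| / (1 / 32 * 1) := div_le_div₀ hsD hnum (by norm_num) hden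
      _ = 32 * |soSymbolD d i.L l γ k| := by ring

/-! ## (3.19): the `L^q` bound, uniformly over the data -/

/-- The constant of (3.19) for the pure derivative of order `γ` at exponent `q`
(depends on `d, γ, q` only). [cite: LiuSlade2026, (3.19)] -/
def CA (d γ : ℕ) (q : ℝ) : ℝ :=
  32 * (4 * (2 * π * q / (q - 1)) ^ ((d : ℝ) / q)) + 32 * d * ((d * 2 ^ d / (d - min (γ : ℝ) 2 * q)) ^ (1 / q))

/-- `∂_l^γ D̂` is continuous on `ℝ^d` (a trigonometric polynomial; through `symbD_soStep`). [folklore] -/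
theorem _root_.Literature.Barriers.CriticalPhenomena.SpreadOutIsing.continuous_soSymbolD (L : ℕ) (l : Fin d) (γ : ℕ) :
    Continuous (soSymbolD d L l γ) := by
  have h : soSymbolD d L l γ = symbD (soStep d L) l γ := funext fun k => (symbD_soStep l γ k).symm
  rw [h]
  exact continuous_symbD (S := (spreadOutGraph d L).neighborFinset 0)
    (fun x hx => soStep_of_not_adj fun h' => hx ((SimpleGraph.mem_neighborFinset _ _ _).2 h')) l γ

/-- Continuity of the blocks on `ℝ^d` (measurability). [folklore] -/
theorem continuous_Ablk (γ : ℕ) : Continuous (i.Ablk l γ) :=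
  (i.continuous_symA l γ).div ((i.continuous_symA l 0).add continuous_const) fun k => (i.Am_pos l k).ne'

/-- **Liu–Slade 2026, (3.19), pure derivatives, uniformly over the admissible data**: for
`γ ≥ 1` and `1 < q < ∞` with `γ/d < 1/q`,
`‖Â_γ/(Â+λm²)‖_{L^q([-π,π]^d)} ≤ C_A(d,γ,q) L^{γ - d/q}`. [cite: LiuSlade2026, Lemma 3.3 (3.11) and (3.19)] -/
theorem eLpNorm_Ablk_le (hd : 3 ≤ d) (hL₀ : 1 ≤ L₀) {γ : ℕ} (hγ : 1 ≤ γ) {q : ℝ} (hq : 1 < q)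
    (hγq : (γ : ℝ) / d < 1 / q) :
    eLpNorm (i.Ablk l γ) (ENNReal.ofReal q) (volume.restrict (cube d)) ≤
      ENNReal.ofReal (CA d γ q * (i.L : ℝ) ^ ((γ : ℝ) - d / q)) := by
  have hd1 : 1 ≤ d := by omega
  have hd0 : (0 : ℝ) < d := by exact_mod_cast (show 0 < d by omega)
  have hL := i.one_le_L hL₀
  have hL1 : (1 : ℝ) ≤ i.L := by exact_mod_cast hL
  have hL0 : (0 : ℝ) < i.L := by linarith
  have hq0 : 0 < q := by linarith
  have hq1 : (1 : ℝ≥0∞) ≤ ENNReal.ofReal q := by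
    rw [← ENNReal.ofReal_one]; exact ENNReal.ofReal_le_ofReal hq.le
  set a : ℝ := min (γ : ℝ) 2 with ha
  have ha0 : 0 ≤ a := le_min (Nat.cast_nonneg γ) zero_le_two
  have haγ : a ≤ γ := min_le_left _ _
  have hγq' : (γ : ℝ) * q < d := by
    rw [div_lt_div_iff₀ hd0 hq0, one_mul] at hγq; linarith
  have haq : a * q < d := lt_of_le_of_lt (mul_le_mul_of_nonneg_right haγ hq0.le) hγq'
  -- the two majorants
  set g₁ : (Fin d → ℝ) → ℝ := fun k => ‖soSymbolD d i.L l γ k‖ with hg₁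
  set g₂ : (Fin d → ℝ) → ℝ := (Metric.ball (0 : Fin d → ℝ) (i.L : ℝ)⁻¹).indicator (fun k => ‖k‖ ^ (-a)) with hg₂
  set c₂ : ℝ := 32 * d * (i.L : ℝ) ^ ((γ : ℝ) - a) with hc₂
  have hc₂0 : 0 ≤ c₂ := by rw [hc₂]; positivity
  have hdom : ∀ᵐ k ∂(volume.restrict (cube d)), ‖i.Ablk l γ k‖ ≤ ((32 : ℝ) • g₁ + c₂ • g₂) k := by
    filter_upwards [ae_ne_zero_restrict_cube hd1, self_mem_ae_restrict (measurableSet_cube d)] with k hk0 hk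
    rw [Real.norm_eq_abs]
    have h := i.abs_Ablk_le l hd1 hL₀ hγ hk hk0
    simp only [Pi.add_apply, Pi.smul_apply, smul_eq_mul, hg₁, hg₂, hc₂, Real.norm_eq_abs]
    exact h
  have hm₁ : AEStronglyMeasurable g₁ (volume.restrict (cube d)) :=
    (continuous_soSymbolD i.L l γ).norm.aestronglyMeasurable
  have hm₂ : AEStronglyMeasurable g₂ (volume.restrict (cube d)) := by
    refine AEStronglyMeasurable.indicator ?_ Metric.isOpen_ball.measurableSet
    exact (continuous_norm.measurable.pow_const _).aestronglyMeasurable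
  -- the two norms
  have hn₁ : eLpNorm g₁ (ENNReal.ofReal q) (volume.restrict (cube d)) ≤
      ENNReal.ofReal (4 * (2 * π * q / (q - 1)) ^ ((d : ℝ) / q) * (i.L : ℝ) ^ ((γ : ℝ) - d / q)) := by
    rw [hg₁, eLpNorm_norm]
    exact eLpNorm_soSymbolD_le hd1 hL l hγ hq
  have hn₂ : eLpNorm g₂ (ENNReal.ofReal q) (volume.restrict (cube d)) ≤
      ENNReal.ofReal ((d * 2 ^ d / (d - a * q)) ^ (1 / q) * (i.L : ℝ) ^ (a - (d : ℝ) / q)) :=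
    eLpNorm_norm_rpow_neg_indicator_ball_inv_le hd1 hq0 haq hL0
  -- assemble
  have hA : 0 ≤ 4 * (2 * π * q / (q - 1)) ^ ((d : ℝ) / q) := by
    have : 0 < q - 1 := by linarith
    positivity
  have hB : 0 ≤ (d * 2 ^ d / (d - a * q)) ^ (1 / q) := by
    have : 0 < (d : ℝ) - a * q := by linarith
    positivity
  calc eLpNorm (i.Ablk l γ) (ENNReal.ofReal q) (volume.restrict (cube d))
      ≤ eLpNorm ((32 : ℝ) • g₁ + c₂ • g₂) (ENNReal.ofReal q) (volume.restrict (cube d)) := eLpNorm_mono_ae_real hdom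
    _ ≤ eLpNorm ((32 : ℝ) • g₁) (ENNReal.ofReal q) (volume.restrict (cube d)) +
          eLpNorm (c₂ • g₂) (ENNReal.ofReal q) (volume.restrict (cube d)) :=
        eLpNorm_add_le (hm₁.const_smul _) (hm₂.const_smul _) hq1
    _ = ENNReal.ofReal 32 * eLpNorm g₁ (ENNReal.ofReal q) (volume.restrict (cube d)) +
          ENNReal.ofReal c₂ * eLpNorm g₂ (ENNReal.ofReal q) (volume.restrict (cube d)) := by
        rw [eLpNorm_const_smul, eLpNorm_const_smul, Real.enorm_eq_ofReal (by norm_num : (0:ℝ) ≤ 32),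
          Real.enorm_eq_ofReal hc₂0]
    _ ≤ ENNReal.ofReal 32 * ENNReal.ofReal (4 * (2 * π * q / (q - 1)) ^ ((d : ℝ) / q) * (i.L : ℝ) ^ ((γ : ℝ) - d / q)) +
          ENNReal.ofReal c₂ * ENNReal.ofReal ((d * 2 ^ d / (d - a * q)) ^ (1 / q) * (i.L : ℝ) ^ (a - (d : ℝ) / q)) := by
        gcongr
    _ = ENNReal.ofReal (CA d γ q * (i.L : ℝ) ^ ((γ : ℝ) - d / q)) := by
        rw [← ENNReal.ofReal_mul (by norm_num), ← ENNReal.ofReal_mul hc₂0,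
          ← ENNReal.ofReal_add (by positivity) (by positivity)]
        congr 1
        rw [CA, ← ha, hc₂]
        have hLL : (i.L : ℝ) ^ ((γ : ℝ) - a) * (i.L : ℝ) ^ (a - (d : ℝ) / q) = (i.L : ℝ) ^ ((γ : ℝ) - d / q) := by
          rw [← Real.rpow_add hL0]; congr 1; ring
        calc 32 * (4 * (2 * π * q / (q - 1)) ^ ((d : ℝ) / q) * (i.L : ℝ) ^ ((γ : ℝ) - d / q)) +
              32 * d * (i.L : ℝ) ^ ((γ : ℝ) - a) * ((d * 2 ^ d / (d - a * q)) ^ (1 / q) * (i.L : ℝ) ^ (a - (d : ℝ) / q))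
            = 32 * (4 * (2 * π * q / (q - 1)) ^ ((d : ℝ) / q)) * (i.L : ℝ) ^ ((γ : ℝ) - d / q) +
              32 * d * (d * 2 ^ d / (d - a * q)) ^ (1 / q) * ((i.L : ℝ) ^ ((γ : ℝ) - a) * (i.L : ℝ) ^ (a - (d : ℝ) / q)) := by ring
          _ = _ := by rw [hLL]; ring

/-- `C_A ≥ 0`. [folklore] -/
theorem CA_nonneg {γ : ℕ} {q : ℝ} (hq : 1 < q) (hγq : min (γ : ℝ) 2 * q < d) : 0 ≤ CA d γ q := by
  unfold CA
  have : 0 < q - 1 := by linarith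
  have : 0 < (d : ℝ) - min (γ : ℝ) 2 * q := by linarith
  positivity

/-- **The block `Â_γ/(Â+λm²)` is of weak Lebesgue class `γ`** over the admissible data (`γ ≥ 1`;
`LS24.IsWL`): the form of (3.10)–(3.11) consumed by the Hölder bookkeeping.
[cite: LiuSlade2026, Lemma 3.3 (3.10)] -/
theorem isWL_Ablk (hd : 3 ≤ d) (hL₀ : 1 ≤ L₀) {γ : ℕ} (hγ : 1 ≤ γ) :
    LS24.IsWL d γ (fun i : LSData d ρ βs K Kl L₀ => i.Ablk l γ) := by
  have hd0 : (0 : ℝ) < d := by exact_mod_cast (show 0 < d by omega)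
  refine ⟨fun i => (i.continuous_Ablk l γ).aestronglyMeasurable, fun p hp hγp => ?_⟩
  -- an exponent `q > 1`, `q ≥ p`, still in the window
  set q : ℝ := max p (2 * d / (γ + d)) with hqdef
  have hγ0 : (0 : ℝ) < γ := by exact_mod_cast hγ
  have hγd : (γ : ℝ) < d := by
    have := hγp; rw [div_lt_div_iff₀ hd0 (by linarith), one_mul] at this; nlinarith
  have hq1 : 1 < q := by
    have : (1 : ℝ) < 2 * d / (γ + d) := by
      rw [lt_div_iff₀ (by positivity)]
      linarith
    exact lt_of_lt_of_le this (le_max_right _ _)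
  have hq0 : 0 < q := by linarith
  have hpq : p ≤ q := le_max_left _ _
  have hγq : (γ : ℝ) / d < 1 / q := by
    rcases le_total p (2 * d / (γ + d)) with h | h
    · rw [hqdef, max_eq_right h, one_div_div]
      rw [div_lt_div_iff₀ hd0 (by positivity)]
      nlinarith [mul_pos (sub_pos.2 hγd) hd0]
    · rw [hqdef, max_eq_left h]; exact hγp
  have haq : min (γ : ℝ) 2 * q < d := by
    have h1 : (γ : ℝ) * q < d := by rw [div_lt_div_iff₀ hd0 hq0, one_mul] at hγq; linarith
    exact lt_of_le_of_lt (mul_le_mul_of_nonneg_right (min_le_left _ _) hq0.le) h1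
  have hCA := CA_nonneg (d := d) hq1 haq
  -- the finite measure of the cube
  have hvol : (volume.restrict (cube d)) Set.univ ≠ ∞ := by
    rw [Measure.restrict_apply_univ]
    exact ((isCompact_univ_pi fun (_ : Fin d) => isCompact_Icc).measure_lt_top).ne
  set V : ℝ≥0∞ := (volume.restrict (cube d)) Set.univ ^ (1 / p - 1 / q) with hV
  have hVfin : V ≠ ∞ := ENNReal.rpow_ne_top_of_nonneg (by
    rw [sub_nonneg]; exact one_div_le_one_div_of_le (by linarith) hpq) hvol
  refine ⟨(ENNReal.ofReal (CA d γ q) * V).toNNReal, fun i => ?_⟩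
  have hL1 : (1 : ℝ) ≤ i.L := by exact_mod_cast i.one_le_L hL₀
  have hmain := i.eLpNorm_Ablk_le l hd hL₀ hγ hq1 hγq
  have hLpow : (i.L : ℝ) ^ ((γ : ℝ) - d / q) ≤ 1 := by
    refine Real.rpow_le_one_of_one_le_of_nonpos hL1 ?_
    rw [div_lt_div_iff₀ hd0 hq0, one_mul] at hγq
    rw [sub_nonpos, le_div_iff₀ hq0]; linarith
  have h1 : eLpNorm (i.Ablk l γ) (ENNReal.ofReal q) (volume.restrict (cube d)) ≤ ENNReal.ofReal (CA d γ q) :=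
    hmain.trans (ENNReal.ofReal_le_ofReal (mul_le_of_le_one_right hCA hLpow))
  have hcmp := eLpNorm_le_eLpNorm_mul_rpow_measure_univ (μ := volume.restrict (cube d)) (f := i.Ablk l γ)
    (ENNReal.ofReal_le_ofReal hpq) (i.continuous_Ablk l γ).aestronglyMeasurable
  rw [ENNReal.toReal_ofReal (by linarith), ENNReal.toReal_ofReal hq0.le] at hcmp
  rw [ENNReal.coe_toNNReal (ENNReal.mul_ne_top ENNReal.ofReal_ne_top hVfin)]
  calc eLpNorm (i.Ablk l γ) (ENNReal.ofReal p) (volume.restrict (cube d))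
      ≤ eLpNorm (i.Ablk l γ) (ENNReal.ofReal q) (volume.restrict (cube d)) * V := hcmp
    _ ≤ ENNReal.ofReal (CA d γ q) * V := by gcongr

end LSData

end Literature.Barriers.CriticalPhenomena.SpreadOutIsing

end


/-!
# Liu–Slade 2026, Proposition 3.2 (towards `LiuSlade2026_thm22_holds`), V: Lemma 3.3 for the
# blocks `F̂_γ/(F̂ + m²)` — (3.22)–(3.23), `‖F̂_γ/F̂‖_q ≲ L^{|γ|-d/q} + β`

Barrier catalogue `Literature/Barriers/CriticalPhenomena/` (D-0021), proofs companion of the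
named fact `LiuSlade2026_thm22`, continuing part IV (this file). This file PROVES the second third
of Lemma 3.3 in the classical/massive setting: "Bound on `F̂_γ/F̂`. … if `1 ≤ |γ| < d/2 + 2 + ρ`
then `‖F̂_γ/F̂‖_q ≲ L^{|γ|-d/q} + β ≲ 1` (`|γ|/d < q⁻¹ < 1`) (3.22). By the infrared bound (3.18),
`|F̂_γ/F̂| ≲ L^{-2}|k|^{-2}|F̂_γ|1_{B_L} + |F̂_γ|` (3.23). Since `F̂ = 1 - zD̂ - Π̂` and `|γ| ≥ 1`,
… `‖F̂_γ‖_q ≤ |z|‖D̂_γ‖_q + ‖Π̂_γ‖_q ≲ L^{|γ|-d/q} + β` (3.24) [Lemma 3.5 (ii) with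
`h(x) = i^{|γ|}x^γΠ(x)`]. If `|γ| = 1`, Taylor's theorem and symmetry give
`|F̂_γ(k)| ≲ (L² + β)|k|` …; for `|γ| ≥ 2` … Hölder's inequality" — for pure derivatives `γ e_l`,
uniformly over the admissible data `LSData`, on the cube (Lebesgue measure, sup norm,
`B_L = {‖k‖ < 1/L}`):

* `LSData.den_F` — `F̂_z + m² ≥ K(L²‖k‖² ∧ 1)` on the cube ((2.3) and `F̂_z(0) ≥ 0`);
* `LSData.symbP_eq_trigSum`, `LSData.eLpNorm_symbP_le` — `Π̂_γ` is a finite cosine sum with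
  coefficients `|Π(x)x_l^γ| ≤ β₁⟦x⟧^{-(d+2+ρ-γ)}` (the `x = 0` term drops out for `γ ≥ 1`), whence
  `‖Π̂_γ‖_r ≤ C β₁` for `r ≥ 1`, `r⁻¹ > (γ-2-ρ)/d`, `γ < d/2 + 2 + ρ` — the tree's Hausdorff–Young
  substitute `LS24.eLpNorm_trigSum_le` (dyadic Parseval; `r < 2` through `L²`);
* `LSData.abs_symbP_one_le` — `|Π̂_{e_l}(k)| ≤ d (Σ⟦x⟧^{-(d+ρ)}) β₁ ‖k‖` (the Taylor step for `|γ| = 1`);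
* `LSData.abs_Fblk_one_le`, `LSData.abs_Fblk_two_le` — the pointwise majorants (3.23) for
  `|γ| = 1` (Taylor) and `|γ| ≥ 2`; `LSData.eLpNorm_offBall_F_le` — the off-ball part (3.24);
* `LSData.exists_eLpNorm_Fblk_le` — **(3.22)/(3.11)**: for `γ ≥ 1`, `1 < q`, `γ/d < 1/q` there is
  `C = C(d,ρ,K,γ,q)` with `‖F̂_γ/(F̂+m²)‖_{L^q([-π,π]^d)} ≤ C(L^{γ-d/q} + β)` over the data, with the
  genuine Hölder step for the `Π̂_γ`-part on the small ball when `γ ≥ 2`;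
* `isWL_Fblk` — the family `i ↦ F̂_γ/(F̂+m²)` is of weak Lebesgue class `γ` (`LS24.IsWL`).

## References

* Y. Liu, G. Slade, *Gaussian deconvolution and the lace expansion for spread-out models*,
  Ann. Inst. H. Poincaré Probab. Statist. 62 (2026), arXiv:2310.07640: Lemma 3.3 with
  (3.10)–(3.11), its proof ("Bound on F̂_γ/F̂", (3.22)–(3.24)), Lemma 3.5, (3.6) [LiuSlade2026].
-/

noncomputable section

namespace Literature.Barriers.CriticalPhenomena.SpreadOutIsing

open _root_.MeasureTheory Filter _root_.Topology Finset Literature.Probability.LatticeModels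
open scoped BigOperators Real ENNReal NNReal

variable {d : ℕ}

namespace LSData

variable {ρ βs K Kl : ℝ} {L₀ : ℕ} (i : LSData d ρ βs K Kl L₀) (l : Fin d)

/-! ## The denominator `F̂ + m²` -/

/-- **`F̂_z + m² ≥ K(L²‖k‖² ∧ 1)` on the cube** ((2.3) and `F̂_z(0) ≥ 0`, `m² > 0`; `K ≥ 0`).
[cite: LiuSlade2026, (2.3) and (3.18)] -/
theorem den_F {k : Fin d → ℝ} (hk : k ∈ cube d) :
    K * min ((i.L : ℝ) ^ 2 * ‖k‖ ^ 2) 1 ≤ i.Fm l k := by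
  have h := i.infrared_symF l hk
  have h0 := i.symF_zero_at_zero_nonneg l
  unfold Fm; linarith [i.hmass]

/-- The total mass of the cube: `|[-π,π]^d| = (2π)^d`. [folklore] -/
theorem volume_restrict_cube_univ (d : ℕ) :
    (volume.restrict (cube d) : Measure (Fin d → ℝ)) Set.univ = ENNReal.ofReal ((2 * π) ^ d) := by
  rw [Measure.restrict_apply_univ]
  have hc : cube d = Set.Icc (fun _ : Fin d => -π) (fun _ => π) := Set.pi_univ_Icc _ _
  rw [hc, Real.volume_Icc_pi]
  simp only [sub_neg_eq_add, Finset.prod_const, Finset.card_univ, Fintype.card_fin]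
  rw [← ENNReal.ofReal_pow (by linarith [Real.pi_pos]) d]
  congr 1; ring

/-! ## `Π̂_γ` as a finite cosine sum and its `L^r` bounds -/

/-- `∂_l^γ Π̂ = Σ_{x ∈ S} Π(x) x_l^γ cos(k·x + γπ/2)` is the tree's `LS24.trigSum` with coefficients
`Π(x)x_l^γ` and phase `γπ/2`. [cite: LiuSlade2026, proof of Lemma 3.3 ("Lemma 3.5 (ii) applied with h(x) = i^{|γ|}x^γΠ(x)")] -/
theorem symbP_eq_trigSum (γ : ℕ) (k : Fin d → ℝ) :
    symbD i.P l γ k = LS24.trigSum i.S (fun x => i.P x * ((x l : ℤ) : ℝ) ^ γ) (γ * (π / 2)) k := by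
  rw [symbD_eq_sum i.hS, LS24.trigSum]
  exact Finset.sum_congr rfl fun x _ => by ring

/-- The coefficient decay for `γ ≥ 1`: `|Π(x)x_l^γ| ≤ β₁ ⟦x⟧^{-(d+2+ρ-γ)}` (the `x = 0` term
vanishes). [cite: LiuSlade2026, (2.2)] -/
theorem abs_coeff_le {γ : ℕ} (hγ : 1 ≤ γ) (x : Site d) :
    |i.P x * ((x l : ℤ) : ℝ) ^ γ| ≤ i.β₁ * jnorm x ^ (-((d : ℝ) + 2 + ρ - γ)) := by
  have hj := jnorm_pos x
  by_cases hx : x = 0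
  · subst hx
    simp only [Pi.zero_apply, Int.cast_zero, zero_pow (by omega : γ ≠ 0), mul_zero, abs_zero]
    exact mul_nonneg i.hβ₁ (Real.rpow_nonneg hj.le _)
  · have hP : |i.P x| ≤ i.β₁ / jnorm x ^ ((d : ℝ) + 2 + ρ) := by
      have := i.abs_P_le x; rwa [delta0_of_ne_zero hx, mul_zero, zero_add] at this
    have hxl : |((x l : ℤ) : ℝ)| ^ γ ≤ jnorm x ^ (γ : ℝ) := by
      rw [← Real.rpow_natCast]
      exact Real.rpow_le_rpow (abs_nonneg _) ((abs_apply_le_euclidNorm x l).trans (euclidNorm_le_jnorm x))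
        (Nat.cast_nonneg γ)
    rw [abs_mul, abs_pow]
    calc |i.P x| * |((x l : ℤ) : ℝ)| ^ γ ≤ i.β₁ / jnorm x ^ ((d : ℝ) + 2 + ρ) * jnorm x ^ (γ : ℝ) :=
          mul_le_mul hP hxl (pow_nonneg (abs_nonneg _) _) (div_nonneg i.hβ₁ (Real.rpow_nonneg hj.le _))
      _ = i.β₁ * jnorm x ^ (-((d : ℝ) + 2 + ρ - γ)) := by
          rw [Real.rpow_neg hj.le, div_mul_eq_mul_div, mul_div_assoc, ← Real.rpow_sub hj]
          rw [← Real.rpow_neg hj.le]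
          congr 2; ring

/-- The constant of the `L^r` bound of `Π̂_γ` (`r' = r ∨ 2`; depends on `d, ρ, γ, r` only).
[cite: LiuSlade2026, (3.24)] -/
def CP (d : ℕ) (ρ : ℝ) (γ : ℕ) (r : ℝ) : ℝ :=
  ((2 * π) ^ d) ^ (1 / r - 1 / max r 2) *
    ((2 * π) ^ ((d : ℝ) / max r 2) * 5 ^ d * (1 - (2 : ℝ) ^ (-(((d : ℝ) + 2 + ρ - γ) + d / max r 2 - d)))⁻¹)

/-- **`‖Π̂_γ‖_{L^r([-π,π]^d)} ≤ C_Π(d,ρ,γ,r) β₁`** for `1 ≤ γ < d/2 + 2 + ρ`, `r ≥ 1` with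
`r⁻¹ > (γ - 2 - ρ)/d` — the bound "`‖Π̂_γ‖_q ≲ β`" of (3.24) obtained in the source from
Lemma 3.5 (ii) (Hausdorff–Young), here from the dyadic Parseval bound `LS24.eLpNorm_trigSum_le` at the
exponent `r ∨ 2` and the comparison of `L^r` norms on a finite measure space.
[cite: LiuSlade2026, (3.24) and Lemma 3.5 (ii)] -/
theorem eLpNorm_symbP_le (hd : 3 ≤ d) {γ : ℕ} (hγ1 : 1 ≤ γ) (hγ2 : (γ : ℝ) < d / 2 + 2 + ρ)
    {r : ℝ} (hr : 1 ≤ r) (hrγ : ((γ : ℝ) - 2 - ρ) / d < 1 / r) :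
    eLpNorm (symbD i.P l γ) (ENNReal.ofReal r) (volume.restrict (cube d)) ≤ ENNReal.ofReal (CP d ρ γ r * i.β₁) := by
  have hd0 : (0 : ℝ) < d := by exact_mod_cast (show 0 < d by omega)
  have hr0 : 0 < r := by linarith
  set r' : ℝ := max r 2 with hr'
  have hr'2 : 2 ≤ r' := le_max_right _ _
  have hr'0 : 0 < r' := by linarith
  have hrr' : r ≤ r' := le_max_left _ _
  set b : ℝ := (d : ℝ) + 2 + ρ - γ with hb
  have hb0 : 0 ≤ b := by
    have : (γ : ℝ) < d + 2 + ρ := by linarith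
    linarith
  -- `κ(r') > 0`
  have hκ : 0 < b + d / r' - d := by
    rcases le_total r 2 with h | h
    · rw [hr', max_eq_right h]; rw [hb]; linarith
    · rw [hr', max_eq_left h, hb]
      have : d - b < d / r := by
        rw [div_lt_div_iff₀ hd0 hr0, one_mul] at hrγ
        rw [lt_div_iff₀ hr0, hb]; nlinarith
      linarith
  -- the trigSum bound at `r'`
  have hfun : symbD i.P l γ = LS24.trigSum i.S (fun x => i.P x * ((x l : ℤ) : ℝ) ^ γ) (γ * (π / 2)) :=
    funext fun k => i.symbP_eq_trigSum l γ k
  have hT := LS24.eLpNorm_trigSum_le i.S (c := fun x => i.P x * ((x l : ℤ) : ℝ) ^ γ) i.hβ₁ hb0 hr'2 hκ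
    (fun x _ => i.abs_coeff_le l hγ1 x) (γ * (π / 2))
  -- comparison `r ≤ r'`
  have hmeas : AEStronglyMeasurable (symbD i.P l γ) (volume.restrict (cube d)) :=
    (continuous_symbD i.hS l γ).aestronglyMeasurable
  have hcmp := eLpNorm_le_eLpNorm_mul_rpow_measure_univ (μ := volume.restrict (cube d)) (f := symbD i.P l γ)
    (ENNReal.ofReal_le_ofReal hrr') hmeas
  rw [ENNReal.toReal_ofReal hr0.le, ENNReal.toReal_ofReal hr'0.le] at hcmp
  have hvol : (volume.restrict (cube d)) Set.univ = ENNReal.ofReal ((2 * π) ^ d) := volume_restrict_cube_univ d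
  rw [hvol, ENNReal.ofReal_rpow_of_pos (by positivity)] at hcmp
  refine hcmp.trans ?_
  rw [hfun]
  calc eLpNorm (LS24.trigSum i.S (fun x => i.P x * ((x l : ℤ) : ℝ) ^ γ) (γ * (π / 2))) (ENNReal.ofReal r')
        (volume.restrict (cube d)) * ENNReal.ofReal (((2 * π) ^ d) ^ (1 / r - 1 / r'))
      ≤ ENNReal.ofReal ((2 * π) ^ ((d : ℝ) / r') * 5 ^ d * (1 - (2 : ℝ) ^ (-(b + d / r' - d)))⁻¹ * i.β₁) *
          ENNReal.ofReal (((2 * π) ^ d) ^ (1 / r - 1 / r')) := by gcongr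
    _ = ENNReal.ofReal (CP d ρ γ r * i.β₁) := by
        rw [← ENNReal.ofReal_mul (by
          have : 0 < 1 - (2 : ℝ) ^ (-(b + d / r' - d)) := by
            have : (2 : ℝ) ^ (-(b + d / r' - d)) < 1 := Real.rpow_lt_one_of_one_lt_of_neg (by norm_num) (by linarith)
            linarith
          have := i.hβ₁
          positivity)]
        congr 1
        rw [CP, ← hr', ← hb]
        ring

/-- **The Taylor step for `|γ| = 1`**: `|Π̂_{e_l}(k)| ≤ d (Σ_x⟦x⟧^{-(d+ρ)}) β₁ ‖k‖`
(`Π̂_{e_l}(k) = -Σ_x Π(x)x_l sin(k·x)`, `|sin(k·x)| ≤ |k·x| ≤ d‖k‖|x|`, `|x_l| ≤ |x|`, and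
`Σ_x|x|²|Π(x)| ≤ β₁Σ⟦x⟧^{-(d+ρ)}`). [cite: LiuSlade2026, proof of Lemma 3.3 ("Taylor's Theorem and symmetry give |F̂_γ(k)| ≲ (L² + β)|k|")] -/
theorem abs_symbP_one_le (hρ : 0 < ρ) (k : Fin d → ℝ) :
    |symbD i.P l 1 k| ≤ d * (∑' x : Site d, jnorm x ^ (-((d : ℝ) + ρ))) * i.β₁ * ‖k‖ := by
  set S₂ : ℝ := ∑' x : Site d, jnorm x ^ (-((d : ℝ) + ρ)) with hS₂
  have hs2 : (d : ℝ) < (d : ℝ) + 2 + ρ - 2 := by linarith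
  have hsum := tsum_sq_mul_abs_le_of_lsBound i.hβ₀ i.hβ₁ i.abs_P_le hs2
  rw [show (d : ℝ) + 2 + ρ - 2 = (d : ℝ) + ρ by ring] at hsum
  -- termwise
  rw [symbD_eq_sum i.hS]
  have hkx : ∀ x : Site d, |kdot k x| ≤ d * ‖k‖ * euclidNorm x := by
    intro x
    unfold kdot
    calc |∑ j, k j * (x j : ℝ)| ≤ ∑ j, |k j * (x j : ℝ)| := Finset.abs_sum_le_sum_abs _ _
      _ ≤ ∑ _j : Fin d, ‖k‖ * euclidNorm x := Finset.sum_le_sum fun j _ => by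
          rw [abs_mul]
          exact mul_le_mul (abs_apply_le_norm k j) (abs_apply_le_euclidNorm x j) (abs_nonneg _) (norm_nonneg _)
      _ = d * ‖k‖ * euclidNorm x := by simp; ring
  have hterm : ∀ x ∈ i.S, |i.P x * (((x l : ℤ) : ℝ) ^ 1 * Real.cos (kdot k x + (1 : ℕ) * (π / 2)))| ≤
      d * ‖k‖ * (euclidNorm x ^ 2 * |i.P x|) := by
    intro x _
    rw [pow_one, Nat.cast_one, one_mul, Real.cos_add_pi_div_two, abs_mul, abs_mul, abs_neg]
    calc |i.P x| * (|((x l : ℤ) : ℝ)| * |Real.sin (kdot k x)|)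
        ≤ |i.P x| * (euclidNorm x * (d * ‖k‖ * euclidNorm x)) := by
          refine mul_le_mul_of_nonneg_left (mul_le_mul (abs_apply_le_euclidNorm x l)
            ((Real.abs_sin_le_abs).trans (hkx x)) (abs_nonneg _) (euclidNorm_nonneg x)) (abs_nonneg _)
      _ = d * ‖k‖ * (euclidNorm x ^ 2 * |i.P x|) := by ring
  have hfin : ∑ x ∈ i.S, euclidNorm x ^ 2 * |i.P x| ≤ ∑' x, euclidNorm x ^ 2 * |i.P x| := by
    refine Summable.sum_le_tsum _ (fun x _ => mul_nonneg (sq_nonneg _) (abs_nonneg _)) ?_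
    exact summable_of_ne_finset_zero (s := i.S) fun x hx => by rw [i.hS x hx, abs_zero, mul_zero]
  calc |∑ x ∈ i.S, i.P x * (((x l : ℤ) : ℝ) ^ 1 * Real.cos (kdot k x + (1 : ℕ) * (π / 2)))|
      ≤ ∑ x ∈ i.S, |i.P x * (((x l : ℤ) : ℝ) ^ 1 * Real.cos (kdot k x + (1 : ℕ) * (π / 2)))| := Finset.abs_sum_le_sum_abs _ _
    _ ≤ ∑ x ∈ i.S, d * ‖k‖ * (euclidNorm x ^ 2 * |i.P x|) := Finset.sum_le_sum hterm
    _ = d * ‖k‖ * ∑ x ∈ i.S, euclidNorm x ^ 2 * |i.P x| := by rw [Finset.mul_sum]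
    _ ≤ d * ‖k‖ * (i.β₁ * S₂) := mul_le_mul_of_nonneg_left (hfin.trans hsum) (by positivity)
    _ = d * S₂ * i.β₁ * ‖k‖ := by ring

/-! ## The pointwise majorant of `F̂_γ/(F̂ + m²)` -/

/-- For `γ ≥ 1`: `|F̂_γ| ≤ z|∂_l^γ D̂| + |Π̂_γ|`. [cite: LiuSlade2026, (3.24)] -/
theorem abs_symF_le {γ : ℕ} (hγ : 1 ≤ γ) (k : Fin d → ℝ) :
    |i.symF l γ k| ≤ i.z * |soSymbolD d i.L l γ k| + |symbD i.P l γ k| := by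
  rw [i.symF_eq l γ k, if_neg (by omega), zero_sub]
  have hz : 0 ≤ i.z := le_trans zero_le_one i.one_le_z
  calc |-(i.z * soSymbolD d i.L l γ k) - symbD i.P l γ k|
      ≤ |-(i.z * soSymbolD d i.L l γ k)| + |symbD i.P l γ k| := abs_sub _ _
    _ = i.z * |soSymbolD d i.L l γ k| + |symbD i.P l γ k| := by rw [abs_neg, abs_mul, abs_of_nonneg hz]


/-- **The pointwise majorant of `F̂_γ/(F̂+m²)`, `|γ| = 1`** on the cube off the origin (`z ≤ 2`,
`β₁ ≤ 1`, `K > 0`, `S₂ = Σ⟦x⟧^{-(d+ρ)}`):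
`|F̂_γ/(F̂+m²)| ≤ K⁻¹(2|∂_lD̂| + |Π̂_γ|) + 1_{B_L}(k) K⁻¹d(2 + S₂)‖k‖⁻¹` (Taylor's theorem and symmetry
give `|F̂_γ(k)| ≤ d(2 + S₂)L²‖k‖`, and `F̂ + m² ≥ KL²‖k‖²` on the ball).
[cite: LiuSlade2026, (3.23) and the paragraph following (3.24) (case |γ| = 1)] -/
theorem abs_Fblk_one_le (hd : 1 ≤ d) (hL₀ : 1 ≤ L₀) (hρ : 0 < ρ) (hK : 0 < K) (hz2 : i.z ≤ 2) (hβ1 : i.β₁ ≤ 1)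
    {k : Fin d → ℝ} (hk : k ∈ cube d) (hk0 : k ≠ 0) :
    |i.Fblk l 1 k| ≤ K⁻¹ * (2 * |soSymbolD d i.L l 1 k| + |symbD i.P l 1 k|) +
      (Metric.ball (0 : Fin d → ℝ) (i.L : ℝ)⁻¹).indicator
        (fun k => K⁻¹ * (d * (2 + ∑' x : Site d, jnorm x ^ (-((d : ℝ) + ρ)))) * ‖k‖ ^ (-(1 : ℝ))) k := by
  have hL := i.one_le_L hL₀
  have hL1 : (1 : ℝ) ≤ i.L := by exact_mod_cast hL
  have hL0 : (0 : ℝ) < i.L := by linarith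
  have hkn : 0 < ‖k‖ := norm_pos_iff.2 hk0
  have hden := i.den_F l hk
  have hFm : 0 < i.Fm l k := i.Fm_pos l hK.le k
  have hnum := i.abs_symF_le l le_rfl k
  have hgD0 := abs_nonneg (soSymbolD d i.L l 1 k)
  have hgP0 := abs_nonneg (symbD i.P l 1 k)
  have hS₂0 : 0 ≤ ∑' x : Site d, jnorm x ^ (-((d : ℝ) + ρ)) :=
    tsum_nonneg fun x => Real.rpow_nonneg (jnorm_pos x).le _
  have hnum' : |i.symF l 1 k| ≤ 2 * |soSymbolD d i.L l 1 k| + |symbD i.P l 1 k| := by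
    calc |i.symF l 1 k| ≤ i.z * |soSymbolD d i.L l 1 k| + |symbD i.P l 1 k| := hnum
      _ ≤ _ := by nlinarith
  have hKn : 0 ≤ K⁻¹ * (2 * |soSymbolD d i.L l 1 k| + |symbD i.P l 1 k|) :=
    mul_nonneg (inv_nonneg.2 hK.le) (by positivity)
  rw [Fblk, abs_div, abs_of_pos hFm]
  by_cases hball : ‖k‖ < (i.L : ℝ)⁻¹
  · have hmem : k ∈ Metric.ball (0 : Fin d → ℝ) (i.L : ℝ)⁻¹ := by simpa using hball
    rw [Set.indicator_of_mem hmem]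
    have hLk : (i.L : ℝ) ^ 2 * ‖k‖ ^ 2 < 1 := by
      have h1 : (i.L : ℝ) * ‖k‖ < 1 := by
        calc (i.L : ℝ) * ‖k‖ < i.L * (i.L : ℝ)⁻¹ := mul_lt_mul_of_pos_left hball hL0
          _ = 1 := mul_inv_cancel₀ hL0.ne'
      have h0 : 0 ≤ (i.L : ℝ) * ‖k‖ := by positivity
      nlinarith
    rw [min_eq_left hLk.le] at hden
    have hstep : |i.symF l 1 k| / i.Fm l k ≤ |i.symF l 1 k| / (K * ((i.L : ℝ) ^ 2 * ‖k‖ ^ 2)) :=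
      div_le_div_of_nonneg_left (abs_nonneg _) (by positivity) hden
    have hT : |i.symF l 1 k| ≤ d * (2 + ∑' x : Site d, jnorm x ^ (-((d : ℝ) + ρ))) * (i.L : ℝ) ^ 2 * ‖k‖ := by
      have h1 := abs_soSymbolD_one_le hd hL l k
      have h2 := i.abs_symbP_one_le l hρ k
      have hz0 : 0 ≤ i.z := le_trans zero_le_one i.one_le_z
      have hkL : ‖k‖ ≤ (i.L : ℝ) ^ 2 * ‖k‖ := by
        calc ‖k‖ = 1 * ‖k‖ := (one_mul _).symm
          _ ≤ (i.L : ℝ) ^ 2 * ‖k‖ := mul_le_mul_of_nonneg_right (one_le_pow₀ hL1) hkn.le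
      have hd0 : (0 : ℝ) ≤ d := Nat.cast_nonneg d
      calc |i.symF l 1 k| ≤ i.z * |soSymbolD d i.L l 1 k| + |symbD i.P l 1 k| := hnum
        _ ≤ 2 * (d * (i.L : ℝ) ^ 2 * ‖k‖) +
              d * (∑' x : Site d, jnorm x ^ (-((d : ℝ) + ρ))) * i.β₁ * ‖k‖ := by
            nlinarith [mul_le_mul hz2 h1 hgD0 zero_le_two]
        _ ≤ 2 * (d * (i.L : ℝ) ^ 2 * ‖k‖) +
              d * (∑' x : Site d, jnorm x ^ (-((d : ℝ) + ρ))) * 1 * ((i.L : ℝ) ^ 2 * ‖k‖) := by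
            gcongr
        _ = d * (2 + ∑' x : Site d, jnorm x ^ (-((d : ℝ) + ρ))) * (i.L : ℝ) ^ 2 * ‖k‖ := by ring
    calc |i.symF l 1 k| / i.Fm l k ≤ |i.symF l 1 k| / (K * ((i.L : ℝ) ^ 2 * ‖k‖ ^ 2)) := hstep
      _ ≤ d * (2 + ∑' x : Site d, jnorm x ^ (-((d : ℝ) + ρ))) * (i.L : ℝ) ^ 2 * ‖k‖ /
            (K * ((i.L : ℝ) ^ 2 * ‖k‖ ^ 2)) := div_le_div_of_nonneg_right hT (by positivity)
      _ = K⁻¹ * (d * (2 + ∑' x : Site d, jnorm x ^ (-((d : ℝ) + ρ)))) * ‖k‖ ^ (-(1 : ℝ)) := by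
          rw [Real.rpow_neg hkn.le, Real.rpow_one]; field_simp
      _ ≤ _ := by linarith
  · have hmem : k ∉ Metric.ball (0 : Fin d → ℝ) (i.L : ℝ)⁻¹ := by simpa using hball
    rw [Set.indicator_of_notMem hmem, add_zero]
    have hLk : 1 ≤ (i.L : ℝ) ^ 2 * ‖k‖ ^ 2 := by
      have h1 : 1 ≤ (i.L : ℝ) * ‖k‖ := by
        rw [not_lt, inv_le_iff_one_le_mul₀ hL0] at hball
        linarith [hball]
      nlinarith
    rw [min_eq_right hLk, mul_one] at hden
    calc |i.symF l 1 k| / i.Fm l k ≤ |i.symF l 1 k| / K := div_le_div_of_nonneg_left (abs_nonneg _) hK hden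
      _ ≤ (2 * |soSymbolD d i.L l 1 k| + |symbD i.P l 1 k|) / K := div_le_div_of_nonneg_right hnum' hK.le
      _ = _ := by rw [div_eq_inv_mul]

/-- **The pointwise majorant of `F̂_γ/(F̂+m²)`, `|γ| ≥ 2`** on the cube off the origin (`z ≤ 2`, `K > 0`):
`|F̂_γ/(F̂+m²)| ≤ K⁻¹(2|∂_l^γD̂| + |Π̂_γ|) + 1_{B_L}(k)(2K⁻¹L^{γ-2}‖k‖⁻² + K⁻¹L⁻²‖k‖⁻²|Π̂_γ(k)|)`
(`|∂_l^γD̂| ≤ L^γ` and `F̂ + m² ≥ KL²‖k‖²` on the ball).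
[cite: LiuSlade2026, (3.23) and the paragraph following (3.24) (case |γ| ≥ 2)] -/
theorem abs_Fblk_two_le (hd : 1 ≤ d) (hL₀ : 1 ≤ L₀) (hK : 0 < K) (hz2 : i.z ≤ 2) {γ : ℕ} (hγ : 2 ≤ γ)
    {k : Fin d → ℝ} (hk : k ∈ cube d) (hk0 : k ≠ 0) :
    |i.Fblk l γ k| ≤ K⁻¹ * (2 * |soSymbolD d i.L l γ k| + |symbD i.P l γ k|) +
      (Metric.ball (0 : Fin d → ℝ) (i.L : ℝ)⁻¹).indicator (fun k =>
        2 * K⁻¹ * (i.L : ℝ) ^ ((γ : ℝ) - 2) * ‖k‖ ^ (-(2 : ℝ)) +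
          K⁻¹ * (i.L : ℝ) ^ (-(2 : ℝ)) * (‖k‖ ^ (-(2 : ℝ)) * |symbD i.P l γ k|)) k := by
  have hL := i.one_le_L hL₀
  have hL1 : (1 : ℝ) ≤ i.L := by exact_mod_cast hL
  have hL0 : (0 : ℝ) < i.L := by linarith
  have hkn : 0 < ‖k‖ := norm_pos_iff.2 hk0
  have hden := i.den_F l hk
  have hFm : 0 < i.Fm l k := i.Fm_pos l hK.le k
  have hγ1 : 1 ≤ γ := by omega
  have hnum := i.abs_symF_le l hγ1 k
  have hgD0 := abs_nonneg (soSymbolD d i.L l γ k)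
  have hgP0 := abs_nonneg (symbD i.P l γ k)
  have hnum' : |i.symF l γ k| ≤ 2 * |soSymbolD d i.L l γ k| + |symbD i.P l γ k| := by
    calc |i.symF l γ k| ≤ i.z * |soSymbolD d i.L l γ k| + |symbD i.P l γ k| := hnum
      _ ≤ _ := by nlinarith
  have hKn : 0 ≤ K⁻¹ * (2 * |soSymbolD d i.L l γ k| + |symbD i.P l γ k|) :=
    mul_nonneg (inv_nonneg.2 hK.le) (by positivity)
  rw [Fblk, abs_div, abs_of_pos hFm]
  by_cases hball : ‖k‖ < (i.L : ℝ)⁻¹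
  · have hmem : k ∈ Metric.ball (0 : Fin d → ℝ) (i.L : ℝ)⁻¹ := by simpa using hball
    rw [Set.indicator_of_mem hmem]
    have hLk : (i.L : ℝ) ^ 2 * ‖k‖ ^ 2 < 1 := by
      have h1 : (i.L : ℝ) * ‖k‖ < 1 := by
        calc (i.L : ℝ) * ‖k‖ < i.L * (i.L : ℝ)⁻¹ := mul_lt_mul_of_pos_left hball hL0
          _ = 1 := mul_inv_cancel₀ hL0.ne'
      have h0 : 0 ≤ (i.L : ℝ) * ‖k‖ := by positivity
      nlinarith
    rw [min_eq_left hLk.le] at hden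
    have hstep : |i.symF l γ k| / i.Fm l k ≤ |i.symF l γ k| / (K * ((i.L : ℝ) ^ 2 * ‖k‖ ^ 2)) :=
      div_le_div_of_nonneg_left (abs_nonneg _) (by positivity) hden
    have hDsup : |soSymbolD d i.L l γ k| ≤ (i.L : ℝ) ^ γ := abs_soSymbolD_le hd hL l γ k
    calc |i.symF l γ k| / i.Fm l k ≤ |i.symF l γ k| / (K * ((i.L : ℝ) ^ 2 * ‖k‖ ^ 2)) := hstep
      _ ≤ (2 * (i.L : ℝ) ^ γ + |symbD i.P l γ k|) / (K * ((i.L : ℝ) ^ 2 * ‖k‖ ^ 2)) := by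
          refine div_le_div_of_nonneg_right (hnum'.trans ?_) (by positivity)
          linarith
      _ = 2 * K⁻¹ * (i.L : ℝ) ^ ((γ : ℝ) - 2) * ‖k‖ ^ (-(2 : ℝ)) +
            K⁻¹ * (i.L : ℝ) ^ (-(2 : ℝ)) * (‖k‖ ^ (-(2 : ℝ)) * |symbD i.P l γ k|) := by
          rw [Real.rpow_neg hkn.le, Real.rpow_two, Real.rpow_neg hL0.le, Real.rpow_two,
            Real.rpow_sub hL0, Real.rpow_natCast, Real.rpow_two]
          field_simp
      _ ≤ _ := by linarith
  · have hmem : k ∉ Metric.ball (0 : Fin d → ℝ) (i.L : ℝ)⁻¹ := by simpa using hball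
    rw [Set.indicator_of_notMem hmem, add_zero]
    have hLk : 1 ≤ (i.L : ℝ) ^ 2 * ‖k‖ ^ 2 := by
      have h1 : 1 ≤ (i.L : ℝ) * ‖k‖ := by
        rw [not_lt, inv_le_iff_one_le_mul₀ hL0] at hball
        linarith [hball]
      nlinarith
    rw [min_eq_right hLk, mul_one] at hden
    calc |i.symF l γ k| / i.Fm l k ≤ |i.symF l γ k| / K := div_le_div_of_nonneg_left (abs_nonneg _) hK hden
      _ ≤ (2 * |soSymbolD d i.L l γ k| + |symbD i.P l γ k|) / K := div_le_div_of_nonneg_right hnum' hK.le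
      _ = _ := by rw [div_eq_inv_mul]

/-! ## (3.22): the `L^q` bound, uniformly over the data -/

/-- Two-factor Hölder on the cube for real functions and real exponents (`1/p₁ + 1/p₂ = 1/p`).
[folklore] -/
theorem eLpNorm_mul_le_holder {f g : (Fin d → ℝ) → ℝ} (hf : AEStronglyMeasurable f (volume.restrict (cube d)))
    (hg : AEStronglyMeasurable g (volume.restrict (cube d))) {p₁ p₂ p : ℝ} (hp₁ : 0 < p₁) (hp₂ : 0 < p₂)
    (hp : 0 < p) (h : 1 / p₁ + 1 / p₂ = 1 / p) :
    eLpNorm (fun k => f k * g k) (ENNReal.ofReal p) (volume.restrict (cube d)) ≤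
      eLpNorm f (ENNReal.ofReal p₁) (volume.restrict (cube d)) * eLpNorm g (ENNReal.ofReal p₂) (volume.restrict (cube d)) := by
  haveI := LS24.holderTriple_ofReal hp₁ hp₂ hp h
  have := eLpNorm_le_eLpNorm_mul_eLpNorm_of_nnnorm (μ := volume.restrict (cube d))
    (p := ENNReal.ofReal p₁) (q := ENNReal.ofReal p₂) (r := ENNReal.ofReal p) hf hg (fun a b : ℝ => a * b) 1
    (ae_of_all _ fun k => by simp)
  simpa using this

/-- Continuity of the blocks `F̂_γ/(F̂+m²)` (`K ≥ 0`). [folklore] -/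
theorem continuous_Fblk (hK : 0 ≤ K) (γ : ℕ) : Continuous (i.Fblk l γ) :=
  (i.continuous_symF l γ).div ((i.continuous_symF l 0).add continuous_const) fun k => (i.Fm_pos l hK k).ne'

/-- `C_Π(d,ρ,γ,r) ≥ 0` at an admissible exponent (`r > 0`, `(γ-2-ρ)/d < 1/r`, `γ < d/2 + 2 + ρ`).
[cite: LiuSlade2026, (3.24)] -/
theorem CP_nonneg (hd0 : (0 : ℝ) < d) {γ : ℕ} (hγ2 : (γ : ℝ) < d / 2 + 2 + ρ) {r : ℝ} (hr0 : 0 < r)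
    (hrγ : ((γ : ℝ) - 2 - ρ) / d < 1 / r) : 0 ≤ CP d ρ γ r := by
  have hκ : 0 < ((d : ℝ) + 2 + ρ - γ) + d / max r 2 - d := by
    rcases le_total r 2 with h | h
    · rw [max_eq_right h]; linarith
    · rw [max_eq_left h]
      have : (γ : ℝ) - 2 - ρ < d / r := by
        rw [div_lt_div_iff₀ hd0 hr0, one_mul] at hrγ; rw [lt_div_iff₀ hr0]; linarith
      linarith
  have : 0 < 1 - (2 : ℝ) ^ (-(((d : ℝ) + 2 + ρ - γ) + d / max r 2 - d)) := by
    have := Real.rpow_lt_one_of_one_lt_of_neg (x := (2 : ℝ)) (by norm_num) (neg_lt_zero.2 hκ); linarith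
  unfold CP; positivity

/-- **The off-ball part of (3.23)–(3.24)**: for `1 ≤ γ < d/2+2+ρ`, `1 < q`, `γ/d < 1/q`,
`‖K⁻¹(2|∂_l^γD̂| + |Π̂_γ|)‖_{L^q([-π,π]^d)} ≤ K⁻¹(2·4(2πq/(q-1))^{d/q}·L^{γ-d/q} + C_Π β₁)`
((2.5) [`eLpNorm_soSymbolD_le`] and `eLpNorm_symbP_le`). [cite: LiuSlade2026, (3.24)] -/
theorem eLpNorm_offBall_F_le (hd : 3 ≤ d) (hL₀ : 1 ≤ L₀) (hρ : 0 < ρ) (hK : 0 < K) {γ : ℕ} (hγ : 1 ≤ γ)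
    (hγ2 : (γ : ℝ) < d / 2 + 2 + ρ) {q : ℝ} (hq : 1 < q) (hγq : (γ : ℝ) / d < 1 / q) :
    eLpNorm (K⁻¹ • (((2 : ℝ) • fun k => ‖soSymbolD d i.L l γ k‖) + fun k => ‖symbD i.P l γ k‖))
        (ENNReal.ofReal q) (volume.restrict (cube d)) ≤
      ENNReal.ofReal (K⁻¹ * (2 * (4 * (2 * π * q / (q - 1)) ^ ((d : ℝ) / q) * (i.L : ℝ) ^ ((γ : ℝ) - d / q)) +
        CP d ρ γ q * i.β₁)) := by
  have hd1 : 1 ≤ d := by omega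
  have hd0 : (0 : ℝ) < d := by exact_mod_cast (show 0 < d by omega)
  have hL := i.one_le_L hL₀
  have hq0 : 0 < q := by linarith
  have hq1 : 0 < q - 1 := by linarith
  have hqE : (1 : ℝ≥0∞) ≤ ENNReal.ofReal q := by
    rw [← ENNReal.ofReal_one]; exact ENNReal.ofReal_le_ofReal hq.le
  have hKi : 0 ≤ K⁻¹ := inv_nonneg.2 hK.le
  have hqγ' : ((γ : ℝ) - 2 - ρ) / d < 1 / q :=
    lt_of_le_of_lt (div_le_div_of_nonneg_right (by linarith) hd0.le) hγq
  have hCPq : 0 ≤ CP d ρ γ q * i.β₁ := mul_nonneg (CP_nonneg hd0 hγ2 hq0 hqγ') i.hβ₁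
  have hmD : AEStronglyMeasurable (fun k => ‖soSymbolD d i.L l γ k‖) (volume.restrict (cube d)) :=
    (continuous_soSymbolD i.L l γ).norm.aestronglyMeasurable
  have hmP : AEStronglyMeasurable (fun k => ‖symbD i.P l γ k‖) (volume.restrict (cube d)) :=
    (continuous_symbD i.hS l γ).norm.aestronglyMeasurable
  have hnD : eLpNorm (fun k => ‖soSymbolD d i.L l γ k‖) (ENNReal.ofReal q) (volume.restrict (cube d)) ≤
      ENNReal.ofReal (4 * (2 * π * q / (q - 1)) ^ ((d : ℝ) / q) * (i.L : ℝ) ^ ((γ : ℝ) - d / q)) := by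
    rw [eLpNorm_norm]; exact eLpNorm_soSymbolD_le hd1 hL l hγ hq
  have hnP : eLpNorm (fun k => ‖symbD i.P l γ k‖) (ENNReal.ofReal q) (volume.restrict (cube d)) ≤
      ENNReal.ofReal (CP d ρ γ q * i.β₁) := by
    rw [eLpNorm_norm]; exact i.eLpNorm_symbP_le l hd hγ hγ2 hq.le hqγ'
  rw [eLpNorm_const_smul, Real.enorm_eq_ofReal hKi, ENNReal.ofReal_mul hKi]
  gcongr
  calc eLpNorm (((2 : ℝ) • fun k => ‖soSymbolD d i.L l γ k‖) + fun k => ‖symbD i.P l γ k‖) (ENNReal.ofReal q)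
        (volume.restrict (cube d))
      ≤ eLpNorm ((2 : ℝ) • fun k => ‖soSymbolD d i.L l γ k‖) (ENNReal.ofReal q) (volume.restrict (cube d)) +
          eLpNorm (fun k => ‖symbD i.P l γ k‖) (ENNReal.ofReal q) (volume.restrict (cube d)) :=
        eLpNorm_add_le (hmD.const_smul _) hmP hqE
    _ ≤ ENNReal.ofReal 2 * ENNReal.ofReal (4 * (2 * π * q / (q - 1)) ^ ((d : ℝ) / q) * (i.L : ℝ) ^ ((γ : ℝ) - d / q)) +
          ENNReal.ofReal (CP d ρ γ q * i.β₁) := by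
        rw [eLpNorm_const_smul, Real.enorm_eq_ofReal zero_le_two]; gcongr
    _ = _ := by rw [← ENNReal.ofReal_mul zero_le_two, ← ENNReal.ofReal_add (by positivity) hCPq]

/-- The Hölder exponents of the small-ball step for `|γ| ≥ 2`: given `1 < q`, `γ/d < 1/q` (`d ≥ 3`),
with `ε = (1/q - γ/d)/2`, `1/s = 2/d + ε` and `1/r = 1/q - 1/s` one has `r ≥ 1`, `s > 0`, `2s < d`,
`1/s + 1/r = 1/q` and `(γ-2-ρ)/d < 1/r`. [cite: LiuSlade2026, proof of Lemma 3.3 ("for q⁻¹ = r⁻¹ + p⁻¹ and p⁻¹ > 2/d")] -/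
theorem exists_holder_exponents_F (hd : 3 ≤ d) (hρ : 0 < ρ) {γ : ℕ} (hγ : 2 ≤ γ) {q : ℝ} (hq : 1 < q)
    (hγq : (γ : ℝ) / d < 1 / q) :
    ∃ r s : ℝ, 0 < r ∧ 1 ≤ r ∧ 0 < s ∧ 2 * s < d ∧ 1 / s + 1 / r = 1 / q ∧ ((γ : ℝ) - 2 - ρ) / d < 1 / r := by
  have hd0 : (0 : ℝ) < d := by exact_mod_cast (show 0 < d by omega)
  have hd3 : (3 : ℝ) ≤ d := by exact_mod_cast hd
  have hq0 : 0 < q := by linarith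
  have hγ2r : (2 : ℝ) ≤ γ := by exact_mod_cast hγ
  obtain ⟨ε, hε⟩ : ∃ ε : ℝ, ε = (1 / q - (γ : ℝ) / d) / 2 := ⟨_, rfl⟩
  have hε0 : 0 < ε := by rw [hε]; linarith
  have hdinv : (0 : ℝ) < 1 / d := by positivity
  have h2d : (2 : ℝ) / d = 2 * (1 / d) := by ring
  have hγd : (γ : ℝ) / d = γ * (1 / d) := by ring
  have hγd2 : 2 * (1 / (d : ℝ)) ≤ (γ : ℝ) * (1 / d) := mul_le_mul_of_nonneg_right hγ2r hdinv.le
  have hq1i : 1 / q < 1 := by rw [div_lt_one hq0]; exact hq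
  obtain ⟨is, his⟩ : ∃ is : ℝ, is = 2 / (d : ℝ) + ε := ⟨_, rfl⟩
  have his0 : 0 < is := by rw [his]; positivity
  obtain ⟨ir, hir⟩ : ∃ ir : ℝ, ir = 1 / q - is := ⟨_, rfl⟩
  have hir0 : 0 < ir := by
    rw [hir, his, hε, h2d, hγd]; rw [hγd] at hγq; nlinarith
  have hir1 : ir < 1 := by rw [hir]; linarith
  refine ⟨1 / ir, 1 / is, by positivity, ?_, by positivity, ?_, ?_, ?_⟩
  · rw [le_div_iff₀ hir0, one_mul]; exact hir1.le
  · have h1 : (2 : ℝ) / d < 1 / (1 / is) := by rw [one_div_one_div, his]; linarith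
    rw [div_lt_div_iff₀ hd0 (by positivity)] at h1; linarith
  · rw [one_div_one_div, one_div_one_div, hir]; ring
  · rw [one_div_one_div, hir, his, hε]
    have : ((γ : ℝ) - 2 - ρ) / d = (γ : ℝ) / d - 2 / d - ρ / d := by ring
    rw [this, h2d, hγd]
    have hρd : 0 < ρ / d := by positivity
    rw [hγd] at hγq
    nlinarith

/-- (3.22) for `|γ| = 1`, uniformly over the data: `‖F̂_γ/(F̂+m²)‖_q ≤ C(L^{1-d/q} + β)` for `1 < q`,
`1/d < 1/q` (Taylor majorant on the ball). [cite: LiuSlade2026, (3.22)–(3.24), case |γ| = 1] -/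
theorem exists_eLpNorm_Fblk_one_le (hd : 3 ≤ d) (hL₀ : 1 ≤ L₀) (hρ : 0 < ρ) (hK : 0 < K)
    (hγ2 : ((1 : ℕ) : ℝ) < d / 2 + 2 + ρ) {q : ℝ} (hq : 1 < q) (hγq : ((1 : ℕ) : ℝ) / d < 1 / q) :
    ∃ C : ℝ, 0 ≤ C ∧ ∀ i : LSData d ρ βs K Kl L₀, i.z ≤ 2 → i.β₁ ≤ 1 →
      eLpNorm (i.Fblk l 1) (ENNReal.ofReal q) (volume.restrict (cube d)) ≤
        ENNReal.ofReal (C * ((i.L : ℝ) ^ (((1 : ℕ) : ℝ) - d / q) + i.β)) := by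
  have hd1 : 1 ≤ d := by omega
  have hd0 : (0 : ℝ) < d := by exact_mod_cast (show 0 < d by omega)
  have hq0 : 0 < q := by linarith
  have hq1' : 0 < q - 1 := by linarith
  have hqE : (1 : ℝ≥0∞) ≤ ENNReal.ofReal q := by
    rw [← ENNReal.ofReal_one]; exact ENNReal.ofReal_le_ofReal hq.le
  have h1q : 1 * q < d := by
    rw [Nat.cast_one, div_lt_div_iff₀ hd0 hq0, one_mul] at hγq; linarith
  have hKi : 0 ≤ K⁻¹ := inv_nonneg.2 hK.le
  have hqγ' : (((1 : ℕ) : ℝ) - 2 - ρ) / d < 1 / q :=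
    lt_of_le_of_lt (div_le_div_of_nonneg_right (by linarith) hd0.le) hγq
  have hCPq := CP_nonneg (ρ := ρ) hd0 hγ2 hq0 hqγ'
  have hS₂0 : 0 ≤ ∑' x : Site d, jnorm x ^ (-((d : ℝ) + ρ)) :=
    tsum_nonneg fun x => Real.rpow_nonneg (jnorm_pos x).le _
  have hDq0 : 0 ≤ 4 * (2 * π * q / (q - 1)) ^ ((d : ℝ) / q) := by positivity
  have hH0 : 0 ≤ (d * 2 ^ d / (d - 1 * q)) ^ (1 / q) :=
    Real.rpow_nonneg (div_nonneg (by positivity) (by linarith)) _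
  have hc0 : 0 ≤ K⁻¹ * (d * (2 + ∑' x : Site d, jnorm x ^ (-((d : ℝ) + ρ)))) :=
    mul_nonneg hKi (mul_nonneg (Nat.cast_nonneg d) (by linarith))
  refine ⟨K⁻¹ * (2 * (4 * (2 * π * q / (q - 1)) ^ ((d : ℝ) / q)) + CP d ρ 1 q) +
      K⁻¹ * (d * (2 + ∑' x : Site d, jnorm x ^ (-((d : ℝ) + ρ)))) * (d * 2 ^ d / (d - 1 * q)) ^ (1 / q),
    add_nonneg (mul_nonneg hKi (add_nonneg (mul_nonneg zero_le_two hDq0) hCPq)) (mul_nonneg hc0 hH0),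
    fun i hz2 hβ1 => ?_⟩
  have hL := i.one_le_L hL₀
  have hL1 : (1 : ℝ) ≤ i.L := by exact_mod_cast hL
  have hL0 : (0 : ℝ) < i.L := by linarith
  have hβ := i.β_nonneg
  have hβ₁β := i.β₁_le_β
  have hβ₁ := i.hβ₁
  have hX0 : 0 ≤ (i.L : ℝ) ^ (((1 : ℕ) : ℝ) - d / q) := Real.rpow_nonneg hL0.le _
  have hmh : AEStronglyMeasurable
      ((Metric.ball (0 : Fin d → ℝ) (i.L : ℝ)⁻¹).indicator (fun k : Fin d → ℝ => ‖k‖ ^ (-(1 : ℝ))))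
        (volume.restrict (cube d)) :=
    ((continuous_norm.measurable.pow_const _).aestronglyMeasurable).indicator Metric.isOpen_ball.measurableSet
  have hmO : AEStronglyMeasurable
      (K⁻¹ • (((2 : ℝ) • fun k => ‖soSymbolD d i.L l 1 k‖) + fun k => ‖symbD i.P l 1 k‖))
      (volume.restrict (cube d)) :=
    ((((continuous_soSymbolD i.L l 1).norm.aestronglyMeasurable).const_smul _).add
      (continuous_symbD i.hS l 1).norm.aestronglyMeasurable).const_smul _
  have hdom : ∀ᵐ k ∂(volume.restrict (cube d)), ‖i.Fblk l 1 k‖ ≤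
      (K⁻¹ • (((2 : ℝ) • fun k => ‖soSymbolD d i.L l 1 k‖) + fun k => ‖symbD i.P l 1 k‖) +
        (K⁻¹ * (d * (2 + ∑' x : Site d, jnorm x ^ (-((d : ℝ) + ρ))))) •
          (Metric.ball (0 : Fin d → ℝ) (i.L : ℝ)⁻¹).indicator (fun k => ‖k‖ ^ (-(1 : ℝ)))) k := by
    filter_upwards [ae_ne_zero_restrict_cube hd1, self_mem_ae_restrict (measurableSet_cube d)] with k hk0 hk
    rw [Real.norm_eq_abs]
    have h := i.abs_Fblk_one_le l hd1 hL₀ hρ hK hz2 hβ1 hk hk0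
    simp only [Pi.add_apply, Pi.smul_apply, smul_eq_mul, Real.norm_eq_abs]
    by_cases hkB : k ∈ Metric.ball (0 : Fin d → ℝ) (i.L : ℝ)⁻¹
    · simp only [Set.indicator_of_mem hkB] at h ⊢
      linarith
    · simp only [Set.indicator_of_notMem hkB, add_zero, mul_zero] at h ⊢
      linarith
  have hnh : eLpNorm ((Metric.ball (0 : Fin d → ℝ) (i.L : ℝ)⁻¹).indicator (fun k => ‖k‖ ^ (-(1 : ℝ))))
      (ENNReal.ofReal q) (volume.restrict (cube d)) ≤
      ENNReal.ofReal ((d * 2 ^ d / (d - 1 * q)) ^ (1 / q) * (i.L : ℝ) ^ (1 - (d : ℝ) / q)) :=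
    eLpNorm_norm_rpow_neg_indicator_ball_inv_le hd1 hq0 h1q hL0
  have hoff := i.eLpNorm_offBall_F_le l hd hL₀ hρ hK le_rfl hγ2 hq hγq
  calc eLpNorm (i.Fblk l 1) (ENNReal.ofReal q) (volume.restrict (cube d))
      ≤ eLpNorm ((K⁻¹ • (((2 : ℝ) • fun k => ‖soSymbolD d i.L l 1 k‖) + fun k => ‖symbD i.P l 1 k‖) +
          (K⁻¹ * (d * (2 + ∑' x : Site d, jnorm x ^ (-((d : ℝ) + ρ))))) •
            (Metric.ball (0 : Fin d → ℝ) (i.L : ℝ)⁻¹).indicator (fun k => ‖k‖ ^ (-(1 : ℝ)))))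
          (ENNReal.ofReal q) (volume.restrict (cube d)) := eLpNorm_mono_ae_real hdom
    _ ≤ eLpNorm (K⁻¹ • (((2 : ℝ) • fun k => ‖soSymbolD d i.L l 1 k‖) + fun k => ‖symbD i.P l 1 k‖))
            (ENNReal.ofReal q) (volume.restrict (cube d)) +
          eLpNorm ((K⁻¹ * (d * (2 + ∑' x : Site d, jnorm x ^ (-((d : ℝ) + ρ))))) •
            (Metric.ball (0 : Fin d → ℝ) (i.L : ℝ)⁻¹).indicator (fun k => ‖k‖ ^ (-(1 : ℝ))))
            (ENNReal.ofReal q) (volume.restrict (cube d)) :=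
        eLpNorm_add_le hmO (hmh.const_smul _) hqE
    _ ≤ ENNReal.ofReal (K⁻¹ * (2 * (4 * (2 * π * q / (q - 1)) ^ ((d : ℝ) / q) *
            (i.L : ℝ) ^ (((1 : ℕ) : ℝ) - d / q)) + CP d ρ 1 q * i.β₁)) +
          ENNReal.ofReal (K⁻¹ * (d * (2 + ∑' x : Site d, jnorm x ^ (-((d : ℝ) + ρ))))) *
            ENNReal.ofReal ((d * 2 ^ d / (d - 1 * q)) ^ (1 / q) * (i.L : ℝ) ^ (1 - (d : ℝ) / q)) := by
        rw [eLpNorm_const_smul _ (Set.indicator _ _), Real.enorm_eq_ofReal hc0]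
        exact add_le_add hoff (mul_le_mul' le_rfl hnh)
    _ = ENNReal.ofReal (K⁻¹ * (2 * (4 * (2 * π * q / (q - 1)) ^ ((d : ℝ) / q) *
            (i.L : ℝ) ^ (((1 : ℕ) : ℝ) - d / q)) + CP d ρ 1 q * i.β₁) +
          K⁻¹ * (d * (2 + ∑' x : Site d, jnorm x ^ (-((d : ℝ) + ρ)))) *
            ((d * 2 ^ d / (d - 1 * q)) ^ (1 / q) * (i.L : ℝ) ^ (1 - (d : ℝ) / q))) := by
        rw [← ENNReal.ofReal_mul hc0, ← ENNReal.ofReal_add (by positivity) (by positivity)]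
    _ ≤ _ := by
        refine ENNReal.ofReal_le_ofReal ?_
        have hX1 : (i.L : ℝ) ^ (1 - (d : ℝ) / q) = (i.L : ℝ) ^ (((1 : ℕ) : ℝ) - d / q) := by norm_num
        rw [hX1]
        nlinarith [mul_nonneg (mul_nonneg hKi hDq0) hβ, mul_nonneg (mul_nonneg hKi hCPq) hX0,
          mul_nonneg (mul_nonneg hKi hCPq) (sub_nonneg.2 hβ₁β), mul_nonneg (mul_nonneg hc0 hH0) hβ,
          mul_nonneg (mul_nonneg hc0 hH0) hX0, mul_nonneg (mul_nonneg hKi hDq0) hX0]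

/-- (3.22) for `|γ| ≥ 2`, uniformly over the data: `‖F̂_γ/(F̂+m²)‖_q ≤ C(L^{γ-d/q} + β)` for `1 < q`,
`γ/d < 1/q`, `γ < d/2 + 2 + ρ` (Hölder on the ball with the exponents of `exists_holder_exponents_F`).
[cite: LiuSlade2026, (3.22)–(3.24), case |γ| ≥ 2] -/
theorem exists_eLpNorm_Fblk_two_le (hd : 3 ≤ d) (hL₀ : 1 ≤ L₀) (hρ : 0 < ρ) (hK : 0 < K) {γ : ℕ}
    (hγ : 2 ≤ γ) (hγ2 : (γ : ℝ) < d / 2 + 2 + ρ) {q : ℝ} (hq : 1 < q) (hγq : (γ : ℝ) / d < 1 / q) :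
    ∃ C : ℝ, 0 ≤ C ∧ ∀ i : LSData d ρ βs K Kl L₀, i.z ≤ 2 → i.β₁ ≤ 1 →
      eLpNorm (i.Fblk l γ) (ENNReal.ofReal q) (volume.restrict (cube d)) ≤
        ENNReal.ofReal (C * ((i.L : ℝ) ^ ((γ : ℝ) - d / q) + i.β)) := by
  have hd1 : 1 ≤ d := by omega
  have hd0 : (0 : ℝ) < d := by exact_mod_cast (show 0 < d by omega)
  have hq0 : 0 < q := by linarith
  have hq1' : 0 < q - 1 := by linarith
  have hqE : (1 : ℝ≥0∞) ≤ ENNReal.ofReal q := by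
    rw [← ENNReal.ofReal_one]; exact ENNReal.ofReal_le_ofReal hq.le
  have hγ1 : 1 ≤ γ := by omega
  have hγ2r : (2 : ℝ) ≤ γ := by exact_mod_cast hγ
  have hγq' : (γ : ℝ) * q < d := by rw [div_lt_div_iff₀ hd0 hq0, one_mul] at hγq; linarith
  have h2q : 2 * q < d := by nlinarith
  have hKi : 0 ≤ K⁻¹ := inv_nonneg.2 hK.le
  have hqγ' : ((γ : ℝ) - 2 - ρ) / d < 1 / q :=
    lt_of_le_of_lt (div_le_div_of_nonneg_right (by linarith) hd0.le) hγq
  have hCPq := CP_nonneg (ρ := ρ) hd0 hγ2 hq0 hqγ'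
  have hDq0 : 0 ≤ 4 * (2 * π * q / (q - 1)) ^ ((d : ℝ) / q) := by positivity
  obtain ⟨r, s, hr0, hr1, hs0, h2s, hsum, hrγ⟩ := exists_holder_exponents_F (d := d) hd hρ hγ hq hγq
  have hCPr := CP_nonneg (ρ := ρ) hd0 hγ2 hr0 hrγ
  have hHq0 : 0 ≤ (d * 2 ^ d / (d - 2 * q)) ^ (1 / q) :=
    Real.rpow_nonneg (div_nonneg (by positivity) (by linarith)) _
  have hHs0 : 0 ≤ (d * 2 ^ d / (d - 2 * s)) ^ (1 / s) :=
    Real.rpow_nonneg (div_nonneg (by positivity) (by linarith)) _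
  obtain ⟨C₀, hC₀⟩ : ∃ C₀ : ℝ, C₀ = K⁻¹ * (2 * (4 * (2 * π * q / (q - 1)) ^ ((d : ℝ) / q)) + CP d ρ γ q) +
      2 * K⁻¹ * ((d : ℝ) * (2 : ℝ) ^ (d : ℕ) / ((d : ℝ) - 2 * q)) ^ (1 / q) +
      K⁻¹ * (((d : ℝ) * (2 : ℝ) ^ (d : ℕ) / ((d : ℝ) - 2 * s)) ^ (1 / s) * CP d ρ γ r) := ⟨_, rfl⟩
  have hC₀0 : 0 ≤ C₀ := by
    have h1 : 0 ≤ K⁻¹ * (2 * (4 * (2 * π * q / (q - 1)) ^ ((d : ℝ) / q)) + CP d ρ γ q) :=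
      mul_nonneg hKi (add_nonneg (mul_nonneg zero_le_two hDq0) hCPq)
    have h2 : 0 ≤ 2 * K⁻¹ * (d * 2 ^ d / (d - 2 * q)) ^ (1 / q) := mul_nonneg (mul_nonneg zero_le_two hKi) hHq0
    have h3 : 0 ≤ K⁻¹ * ((d * 2 ^ d / (d - 2 * s)) ^ (1 / s) * CP d ρ γ r) :=
      mul_nonneg hKi (mul_nonneg hHs0 hCPr)
    rw [hC₀]; exact add_nonneg (add_nonneg h1 h2) h3
  refine ⟨C₀, hC₀0, fun i hz2 hβ1 => ?_⟩
  have hL := i.one_le_L hL₀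
  have hL1 : (1 : ℝ) ≤ i.L := by exact_mod_cast hL
  have hL0 : (0 : ℝ) < i.L := by linarith
  have hβ := i.β_nonneg
  have hβ₁β := i.β₁_le_β
  have hβ₁ := i.hβ₁
  have hX0 : 0 ≤ (i.L : ℝ) ^ ((γ : ℝ) - d / q) := Real.rpow_nonneg hL0.le _
  have hcA0 : 0 ≤ 2 * K⁻¹ * (i.L : ℝ) ^ ((γ : ℝ) - 2) := by positivity
  have hcB0 : 0 ≤ K⁻¹ * (i.L : ℝ) ^ (-(2 : ℝ)) := mul_nonneg hKi (Real.rpow_nonneg hL0.le _)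
  have hmh : AEStronglyMeasurable
      ((Metric.ball (0 : Fin d → ℝ) (i.L : ℝ)⁻¹).indicator (fun k : Fin d → ℝ => ‖k‖ ^ (-(2 : ℝ))))
        (volume.restrict (cube d)) :=
    ((continuous_norm.measurable.pow_const _).aestronglyMeasurable).indicator Metric.isOpen_ball.measurableSet
  have hmP : AEStronglyMeasurable (fun k => ‖symbD i.P l γ k‖) (volume.restrict (cube d)) :=
    (continuous_symbD i.hS l γ).norm.aestronglyMeasurable
  have hmO : AEStronglyMeasurable
      (K⁻¹ • (((2 : ℝ) • fun k => ‖soSymbolD d i.L l γ k‖) + fun k => ‖symbD i.P l γ k‖))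
      (volume.restrict (cube d)) :=
    ((((continuous_soSymbolD i.L l γ).norm.aestronglyMeasurable).const_smul _).add hmP).const_smul _
  -- domination by `off-ball + cA • h₂ + cB • (h₂ · |Π̂_γ|)`
  have hdom : ∀ᵐ k ∂(volume.restrict (cube d)), ‖i.Fblk l γ k‖ ≤
      ((K⁻¹ • (((2 : ℝ) • fun k => ‖soSymbolD d i.L l γ k‖) + fun k => ‖symbD i.P l γ k‖)) +
        ((2 * K⁻¹ * (i.L : ℝ) ^ ((γ : ℝ) - 2)) •
            (Metric.ball (0 : Fin d → ℝ) (i.L : ℝ)⁻¹).indicator (fun k => ‖k‖ ^ (-(2 : ℝ))) +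
          (K⁻¹ * (i.L : ℝ) ^ (-(2 : ℝ))) • fun k =>
            (Metric.ball (0 : Fin d → ℝ) (i.L : ℝ)⁻¹).indicator (fun k => ‖k‖ ^ (-(2 : ℝ))) k *
              ‖symbD i.P l γ k‖)) k := by
    filter_upwards [ae_ne_zero_restrict_cube hd1, self_mem_ae_restrict (measurableSet_cube d)] with k hk0 hk
    rw [Real.norm_eq_abs]
    have h := i.abs_Fblk_two_le l hd1 hL₀ hK hz2 hγ hk hk0
    simp only [Pi.add_apply, Pi.smul_apply, smul_eq_mul, Real.norm_eq_abs]
    by_cases hkB : k ∈ Metric.ball (0 : Fin d → ℝ) (i.L : ℝ)⁻¹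
    · simp only [Set.indicator_of_mem hkB] at h ⊢
      linarith
    · simp only [Set.indicator_of_notMem hkB, add_zero, mul_zero, zero_mul] at h ⊢
      linarith
  have hnh₂q : eLpNorm ((Metric.ball (0 : Fin d → ℝ) (i.L : ℝ)⁻¹).indicator (fun k => ‖k‖ ^ (-(2 : ℝ))))
      (ENNReal.ofReal q) (volume.restrict (cube d)) ≤
      ENNReal.ofReal ((d * 2 ^ d / (d - 2 * q)) ^ (1 / q) * (i.L : ℝ) ^ (2 - (d : ℝ) / q)) :=
    eLpNorm_norm_rpow_neg_indicator_ball_inv_le hd1 hq0 h2q hL0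
  have hnh₂s : eLpNorm ((Metric.ball (0 : Fin d → ℝ) (i.L : ℝ)⁻¹).indicator (fun k => ‖k‖ ^ (-(2 : ℝ))))
      (ENNReal.ofReal s) (volume.restrict (cube d)) ≤
      ENNReal.ofReal ((d * 2 ^ d / (d - 2 * s)) ^ (1 / s) * (i.L : ℝ) ^ (2 - (d : ℝ) / s)) :=
    eLpNorm_norm_rpow_neg_indicator_ball_inv_le hd1 hs0 h2s hL0
  have hnPr : eLpNorm (fun k => ‖symbD i.P l γ k‖) (ENNReal.ofReal r) (volume.restrict (cube d)) ≤
      ENNReal.ofReal (CP d ρ γ r * i.β₁) := by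
    rw [eLpNorm_norm]; exact i.eLpNorm_symbP_le l hd hγ1 hγ2 hr1 hrγ
  have hHo := eLpNorm_mul_le_holder (d := d) hmh hmP hs0 hr0 hq0 hsum
  have hoff := i.eLpNorm_offBall_F_le l hd hL₀ hρ hK hγ1 hγ2 hq hγq
  have hL2X : (i.L : ℝ) ^ ((γ : ℝ) - 2) * (i.L : ℝ) ^ (2 - (d : ℝ) / q) = (i.L : ℝ) ^ ((γ : ℝ) - d / q) := by
    rw [← Real.rpow_add hL0]; congr 1; ring
  have hLs : (i.L : ℝ) ^ (-(2 : ℝ)) * (i.L : ℝ) ^ (2 - (d : ℝ) / s) ≤ 1 := by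
    rw [← Real.rpow_add hL0]
    refine Real.rpow_le_one_of_one_le_of_nonpos hL1 ?_
    have : 0 < (d : ℝ) / s := by positivity
    linarith
  calc eLpNorm (i.Fblk l γ) (ENNReal.ofReal q) (volume.restrict (cube d))
      ≤ eLpNorm (((K⁻¹ • (((2 : ℝ) • fun k => ‖soSymbolD d i.L l γ k‖) + fun k => ‖symbD i.P l γ k‖)) +
        ((2 * K⁻¹ * (i.L : ℝ) ^ ((γ : ℝ) - 2)) •
            (Metric.ball (0 : Fin d → ℝ) (i.L : ℝ)⁻¹).indicator (fun k => ‖k‖ ^ (-(2 : ℝ))) +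
          (K⁻¹ * (i.L : ℝ) ^ (-(2 : ℝ))) • fun k =>
            (Metric.ball (0 : Fin d → ℝ) (i.L : ℝ)⁻¹).indicator (fun k => ‖k‖ ^ (-(2 : ℝ))) k *
              ‖symbD i.P l γ k‖))) (ENNReal.ofReal q) (volume.restrict (cube d)) := eLpNorm_mono_ae_real hdom
    _ ≤ eLpNorm (K⁻¹ • (((2 : ℝ) • fun k => ‖soSymbolD d i.L l γ k‖) + fun k => ‖symbD i.P l γ k‖))
            (ENNReal.ofReal q) (volume.restrict (cube d)) +
          (eLpNorm ((2 * K⁻¹ * (i.L : ℝ) ^ ((γ : ℝ) - 2)) •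
              (Metric.ball (0 : Fin d → ℝ) (i.L : ℝ)⁻¹).indicator (fun k => ‖k‖ ^ (-(2 : ℝ))))
              (ENNReal.ofReal q) (volume.restrict (cube d)) +
            eLpNorm ((K⁻¹ * (i.L : ℝ) ^ (-(2 : ℝ))) • fun k =>
              (Metric.ball (0 : Fin d → ℝ) (i.L : ℝ)⁻¹).indicator (fun k => ‖k‖ ^ (-(2 : ℝ))) k *
                ‖symbD i.P l γ k‖) (ENNReal.ofReal q) (volume.restrict (cube d))) := by
        refine (eLpNorm_add_le hmO ?_ hqE).trans (add_le_add le_rfl (eLpNorm_add_le (hmh.const_smul _)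
          ((hmh.mul hmP).const_smul _) hqE))
        exact (hmh.const_smul _).add ((hmh.mul hmP).const_smul _)
    _ ≤ ENNReal.ofReal (K⁻¹ * (2 * (4 * (2 * π * q / (q - 1)) ^ ((d : ℝ) / q) *
            (i.L : ℝ) ^ ((γ : ℝ) - d / q)) + CP d ρ γ q * i.β₁)) +
          (ENNReal.ofReal (2 * K⁻¹ * (i.L : ℝ) ^ ((γ : ℝ) - 2)) *
              ENNReal.ofReal ((d * 2 ^ d / (d - 2 * q)) ^ (1 / q) * (i.L : ℝ) ^ (2 - (d : ℝ) / q)) +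
            ENNReal.ofReal (K⁻¹ * (i.L : ℝ) ^ (-(2 : ℝ))) *
              (ENNReal.ofReal ((d * 2 ^ d / (d - 2 * s)) ^ (1 / s) * (i.L : ℝ) ^ (2 - (d : ℝ) / s)) *
                ENNReal.ofReal (CP d ρ γ r * i.β₁))) := by
        rw [eLpNorm_const_smul _ (Set.indicator _ _), eLpNorm_const_smul (K⁻¹ * (i.L : ℝ) ^ (-(2 : ℝ))),
          Real.enorm_eq_ofReal hcA0, Real.enorm_eq_ofReal hcB0]
        exact add_le_add hoff (add_le_add (mul_le_mul' le_rfl hnh₂q)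
          (mul_le_mul' le_rfl (hHo.trans (mul_le_mul' hnh₂s hnPr))))
    _ = ENNReal.ofReal (K⁻¹ * (2 * (4 * (2 * π * q / (q - 1)) ^ ((d : ℝ) / q) *
            (i.L : ℝ) ^ ((γ : ℝ) - d / q)) + CP d ρ γ q * i.β₁) +
          (2 * K⁻¹ * (d * 2 ^ d / (d - 2 * q)) ^ (1 / q) * ((i.L : ℝ) ^ ((γ : ℝ) - 2) * (i.L : ℝ) ^ (2 - (d : ℝ) / q)) +
            K⁻¹ * ((d * 2 ^ d / (d - 2 * s)) ^ (1 / s) * CP d ρ γ r) * i.β₁ *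
              ((i.L : ℝ) ^ (-(2 : ℝ)) * (i.L : ℝ) ^ (2 - (d : ℝ) / s)))) := by
        have hHqL0 : 0 ≤ (d * 2 ^ d / (d - 2 * q)) ^ (1 / q) * (i.L : ℝ) ^ (2 - (d : ℝ) / q) :=
          mul_nonneg hHq0 (Real.rpow_nonneg hL0.le _)
        have hHsL0 : 0 ≤ (d * 2 ^ d / (d - 2 * s)) ^ (1 / s) * (i.L : ℝ) ^ (2 - (d : ℝ) / s) :=
          mul_nonneg hHs0 (Real.rpow_nonneg hL0.le _)
        have h10 : 0 ≤ K⁻¹ * (2 * (4 * (2 * π * q / (q - 1)) ^ ((d : ℝ) / q) *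
            (i.L : ℝ) ^ ((γ : ℝ) - d / q)) + CP d ρ γ q * i.β₁) :=
          mul_nonneg hKi (add_nonneg (mul_nonneg zero_le_two (mul_nonneg hDq0 hX0)) (mul_nonneg hCPq hβ₁))
        have h20 : 0 ≤ 2 * K⁻¹ * (i.L : ℝ) ^ ((γ : ℝ) - 2) *
            ((d * 2 ^ d / (d - 2 * q)) ^ (1 / q) * (i.L : ℝ) ^ (2 - (d : ℝ) / q)) := mul_nonneg hcA0 hHqL0
        have h30 : 0 ≤ K⁻¹ * (i.L : ℝ) ^ (-(2 : ℝ)) *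
            ((d * 2 ^ d / (d - 2 * s)) ^ (1 / s) * (i.L : ℝ) ^ (2 - (d : ℝ) / s) * (CP d ρ γ r * i.β₁)) :=
          mul_nonneg hcB0 (mul_nonneg hHsL0 (mul_nonneg hCPr hβ₁))
        rw [← ENNReal.ofReal_mul hcA0, ← ENNReal.ofReal_mul hHsL0, ← ENNReal.ofReal_mul hcB0,
          ← ENNReal.ofReal_add h20 h30, ← ENNReal.ofReal_add h10 (add_nonneg h20 h30)]
        congr 1; ring
    _ ≤ _ := by
        refine ENNReal.ofReal_le_ofReal ?_
        rw [hL2X, hC₀]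
        have hlast : K⁻¹ * ((d * 2 ^ d / (d - 2 * s)) ^ (1 / s) * CP d ρ γ r) * i.β₁ *
            ((i.L : ℝ) ^ (-(2 : ℝ)) * (i.L : ℝ) ^ (2 - (d : ℝ) / s)) ≤
            K⁻¹ * ((d * 2 ^ d / (d - 2 * s)) ^ (1 / s) * CP d ρ γ r) * i.β₁ :=
          mul_le_of_le_one_right (by positivity) hLs
        nlinarith [mul_nonneg (mul_nonneg hKi hDq0) hβ, mul_nonneg (mul_nonneg hKi hCPq) hX0,
          mul_nonneg (mul_nonneg hKi hCPq) (sub_nonneg.2 hβ₁β),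
          mul_nonneg (mul_nonneg hKi (mul_nonneg hHs0 hCPr)) (sub_nonneg.2 hβ₁β),
          mul_nonneg (mul_nonneg hKi (mul_nonneg hHs0 hCPr)) hX0,
          mul_nonneg (mul_nonneg (mul_nonneg zero_le_two hKi) hHq0) hβ, hlast]

/-- **Liu–Slade 2026, (3.22)/(3.11), pure derivatives, uniformly over the admissible data**: for
`1 ≤ γ < d/2 + 2 + ρ` and `1 < q < ∞` with `γ/d < 1/q` there is `C = C(d,ρ,K,γ,q) ≥ 0` such that
`‖F̂_γ/(F̂+m²)‖_{L^q([-π,π]^d)} ≤ C (L^{γ - d/q} + β)` for every admissible datum with `z ≤ 2`, `β₁ ≤ 1`.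
(Off the ball `B_L`: (3.24); on it: for `|γ| = 1` the Taylor majorant `‖k‖⁻¹1_{B_L}` with
`‖ ‖k‖⁻¹1_{B_L}‖_q ≲ L^{1-d/q}`; for `|γ| ≥ 2` the term `L^{γ-2}‖k‖⁻²1_{B_L}` likewise and Hölder's
inequality for `L⁻²‖k‖⁻²1_{B_L}|Π̂_γ|`.) [cite: LiuSlade2026, Lemma 3.3 (3.11) and (3.22)–(3.24)] -/
theorem exists_eLpNorm_Fblk_le (hd : 3 ≤ d) (hL₀ : 1 ≤ L₀) (hρ : 0 < ρ) (hK : 0 < K) {γ : ℕ} (hγ : 1 ≤ γ)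
    (hγ2 : (γ : ℝ) < d / 2 + 2 + ρ) {q : ℝ} (hq : 1 < q) (hγq : (γ : ℝ) / d < 1 / q) :
    ∃ C : ℝ, 0 ≤ C ∧ ∀ i : LSData d ρ βs K Kl L₀, i.z ≤ 2 → i.β₁ ≤ 1 →
      eLpNorm (i.Fblk l γ) (ENNReal.ofReal q) (volume.restrict (cube d)) ≤
        ENNReal.ofReal (C * ((i.L : ℝ) ^ ((γ : ℝ) - d / q) + i.β)) := by
  rcases Nat.lt_or_ge γ 2 with h | h
  · obtain rfl : γ = 1 := by omega
    exact exists_eLpNorm_Fblk_one_le l hd hL₀ hρ hK hγ2 hq hγq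
  · exact exists_eLpNorm_Fblk_two_le l hd hL₀ hρ hK h hγ2 hq hγq

/-- **The block `F̂_γ/(F̂+m²)` is of weak Lebesgue class `γ`** over the admissible data
(`1 ≤ γ < d/2 + 2 + ρ`, `βs ≤ 1`, `z ≤ 2` throughout; `LS24.IsWL`), the form of (3.10)–(3.11) consumed
by the Hölder bookkeeping. [cite: LiuSlade2026, Lemma 3.3 (3.10)–(3.11)] -/
theorem isWL_Fblk (hd : 3 ≤ d) (hL₀ : 1 ≤ L₀) (hρ : 0 < ρ) (hK : 0 < K) (hβs : βs ≤ 1)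
    (hz : ∀ i : LSData d ρ βs K Kl L₀, i.z ≤ 2) {γ : ℕ} (hγ : 1 ≤ γ) (hγ2 : (γ : ℝ) < d / 2 + 2 + ρ) :
    LS24.IsWL d γ (fun i : LSData d ρ βs K Kl L₀ => i.Fblk l γ) := by
  have hd0 : (0 : ℝ) < d := by exact_mod_cast (show 0 < d by omega)
  refine ⟨fun i => (i.continuous_Fblk l hK.le γ).aestronglyMeasurable, fun p hp hγp => ?_⟩
  set q : ℝ := max p (2 * d / (γ + d)) with hqdef
  have hγ0 : (0 : ℝ) < γ := by exact_mod_cast hγ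
  have hγd : (γ : ℝ) < d := by
    have := hγp; rw [div_lt_div_iff₀ hd0 (by linarith), one_mul] at this; nlinarith
  have hq1 : 1 < q := by
    have : (1 : ℝ) < 2 * d / (γ + d) := by
      rw [lt_div_iff₀ (by positivity)]; linarith
    exact lt_of_lt_of_le this (le_max_right _ _)
  have hq0 : 0 < q := by linarith
  have hpq : p ≤ q := le_max_left _ _
  have hγq : (γ : ℝ) / d < 1 / q := by
    rcases le_total p (2 * d / (γ + d)) with h | h
    · rw [hqdef, max_eq_right h, one_div_div, div_lt_div_iff₀ hd0 (by positivity)]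
      nlinarith [mul_pos (sub_pos.2 hγd) hd0]
    · rw [hqdef, max_eq_left h]; exact hγp
  obtain ⟨C, hC0, hC⟩ := exists_eLpNorm_Fblk_le (βs := βs) (Kl := Kl) l hd hL₀ hρ hK hγ hγ2 hq1 hγq
  have hvol : (volume.restrict (cube d)) Set.univ ≠ ∞ := by
    rw [volume_restrict_cube_univ]; exact ENNReal.ofReal_ne_top
  set V : ℝ≥0∞ := (volume.restrict (cube d)) Set.univ ^ (1 / p - 1 / q) with hV
  have hVfin : V ≠ ∞ := ENNReal.rpow_ne_top_of_nonneg (by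
    rw [sub_nonneg]; exact one_div_le_one_div_of_le (by linarith) hpq) hvol
  refine ⟨(ENNReal.ofReal (C * 2) * V).toNNReal, fun i => ?_⟩
  have hL1 : (1 : ℝ) ≤ i.L := by exact_mod_cast i.one_le_L hL₀
  have hβ1 : i.β₁ ≤ 1 := i.β₁_le_β.trans (i.β_le.trans hβs)
  have hmain := hC i (hz i) hβ1
  have hLpow : (i.L : ℝ) ^ ((γ : ℝ) - d / q) ≤ 1 := by
    refine Real.rpow_le_one_of_one_le_of_nonpos hL1 ?_
    rw [div_lt_div_iff₀ hd0 hq0, one_mul] at hγq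
    rw [sub_nonpos, le_div_iff₀ hq0]; linarith
  have h1 : eLpNorm (i.Fblk l γ) (ENNReal.ofReal q) (volume.restrict (cube d)) ≤ ENNReal.ofReal (C * 2) := by
    refine hmain.trans (ENNReal.ofReal_le_ofReal (mul_le_mul_of_nonneg_left ?_ hC0))
    linarith [i.β_le.trans hβs]
  have hcmp := eLpNorm_le_eLpNorm_mul_rpow_measure_univ (μ := volume.restrict (cube d)) (f := i.Fblk l γ)
    (ENNReal.ofReal_le_ofReal hpq) (i.continuous_Fblk l hK.le γ).aestronglyMeasurable
  rw [ENNReal.toReal_ofReal (by linarith), ENNReal.toReal_ofReal hq0.le] at hcmp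
  rw [ENNReal.coe_toNNReal (ENNReal.mul_ne_top ENNReal.ofReal_ne_top hVfin)]
  calc eLpNorm (i.Fblk l γ) (ENNReal.ofReal p) (volume.restrict (cube d))
      ≤ eLpNorm (i.Fblk l γ) (ENNReal.ofReal q) (volume.restrict (cube d)) * V := hcmp
    _ ≤ ENNReal.ofReal (C * 2) * V := by gcongr

end LSData

end Literature.Barriers.CriticalPhenomena.SpreadOutIsing

end

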